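import Literature.NumberTheory.LFunctions.DobnerLemma4Tools
import HarnessLib

/-!
# Dobner's Lemma 4 (steepest descent for `B_{t,n}(s)`) — proof, and Newman's conjecture `Λ ≥ 0`

Trunk T-ANT (`Literature/NumberTheory/LFunctions`). Proofs only (no new definitions; the objects
`𝓘 = dobnerI`, `A = dobnerA`, the shift `λ = dobnerShift` and the centre `c = dobnerCenter` live in
`DobnerLemma4Tools.lean`, `B_{t,n} = dobnerB`, the main term and the named fact `Literature.NumberTheory.LFunctions.dobner_lemma4`
in `DobnerSteepestDescent.lean`). This file proves the named fact `Literature.NumberTheory.LFunctions.dobner_lemma4`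
([Dobner2021, Lemma 4], for `F = ζ`: `γ(z) = ½ z(z−1) π^{−z/2} Γ(z/2)`, `ω = ½`, `μ = 0`,
`Q = π^{−1/2}`) following §4 of the source, and deduces `Literature.NumberTheory.LFunctions.rodgers_tao_holds`.
Page numbers refer to the 18-page arXiv rendering `arXiv:2005.05142` held in the literature store
(Lemma 4 stated p. 10, Lemmas 5–7 and the proof of Lemma 4 pp. 11–13, proofs of Lemmas 5–7 §5,
pp. 15–17).

## Contents

1. **Part (iii), large `n`** (`log n > (Im s)^{3/5}/|t|`; source p. 12–13, with Stirling replaced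
   by `Γ(u) ≤ u^u`): shift the line of integration from `Re z = 2` to the steepest-descent abscissa
   `σ = Re J_t(s) + (|t|/2) log n` (`Literature.NumberTheory.LFunctions.integral_dobnerI_vertical_eq`), where
   `|n^{−z} e^{(J−z)²/|t|}| = e^{−(Re J + (|t|/4) log n) log n} e^{−(Im J − Im z)²/|t|}`; since
   `|Re J| ≤ (|t|/10) log n` this is `≤ e^{−0.15 |t| log² n}` times a Gaussian, and
   `‖γ(σ + iv)‖ ≤ Γ(σ/2)(σ + 1 + |v|)²` with `Γ(σ/2) ≤ (0.3|t| log n)^{0.3 |t| log n}` is absorbed by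
   `e^{0.05 |t| log² n}` for `log n` large. Result: `Literature.NumberTheory.LFunctions.dobner_lemma4_large`.
2. **Parts (i)/(ii), the contour** (`log n ≤ (Im s)^{3/5}/|t|`; source p. 11–12): the line
   `Re z = 2` defining `B_{t,n}(s) = (π|t|)^{-1/2} ∫ 𝓘(2+iv) dv` is deformed through the saddle
   point `c = s + log n/(2A)`, `A = 1/|t| + 1/(4s)`. We use the rectangle with corners
   `2 + i(Im c ∓ Y)`, `c ∓ iY` (`Y = (Im s)^{2/3}`; horizontal pieces `H₁, H₂` at heights
   `Im c ∓ Y` instead of the source's slanted ones, which changes nothing in the estimates) and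
   Cauchy's theorem for rectangles (`Complex.integral_boundary_rect_eq_zero_of_differentiableOn`).
   The pieces `V₁, V₂` (the part of the line `Re z = 2` outside the rectangle) and `H₁, H₂` are
   bounded as in [Dobner2021, Lemma 6 and p. 12] (with Stirling replaced by `‖Γ(w)‖ ≤ R^R`): each
   is `O(e^{−c (Im s)^{4/3}})`. Results: `Literature.NumberTheory.LFunctions.integral_dobnerI_two_eq` (contour identity
   `∫ 𝓘(2+iv) dv = (outer part) + ∫_{−Y}^{Y} 𝓘(c+iu) du − i(H₁ − H₂)`) and
   `Literature.NumberTheory.LFunctions.dobner_lemma4_contour`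
   (`‖B_{t,n}(s) − (π|t|)^{-1/2} ∫_{−Y}^{Y} 𝓘(c + iu) du‖ ≤ e^{−(Im s)^{4/3}/(18|t|)}`).
3. **Parts (i)/(ii), the saddle-point segment `M`**: on the vertical segment through
   `c = s + λ`, `λ = log n/(2A)`, the integrand factorises as
   `𝓘(s + ζ) = γ_t(s) n^{−s} e^{Aζ² − ζ log n} · Q(ζ)`, `Q(ζ) = (s+ζ)(s+ζ−1)/(s(s−1)) · e^{E(ζ)}`
   with `E` the error of the second-order expansion of `Γ(s/2 + ζ/2)/Γ(s/2)`
   (`Literature.Analysis.SpecialFunctions.Complex.Gamma_eq_mul_exp_taylor`, the `ψ`-substitute for [Dobner2021, Lemma 5]); the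
   linear terms cancel *by the definition of `J_t`*. On `ζ = λ + iu`:
   `Aζ² − ζ log n = −log² n/(4A) − Au²`, so `M` is a complex Gaussian integral
   (`integral_gaussian_complex`) up to the relative error `Q − 1`, cf. [Dobner2021, (4.4)–(4.5)].
   Results: `Literature.NumberTheory.LFunctions.dobnerI_center_eq`, `Literature.NumberTheory.LFunctions.norm_Q_sub_one_le`
   (`‖Q − 1‖ ≤ e^{‖E‖}(4‖ζ‖/‖s‖ + 2‖E‖)`), `Literature.NumberTheory.LFunctions.dobner_M_estimate`, `Literature.NumberTheory.LFunctions.norm_gaussConst_sub_one_le`.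
4. **Assembly**: `Literature.NumberTheory.LFunctions.dobner_segment_bound` (the relative error on the segment),
   `Literature.NumberTheory.LFunctions.dobner_lemma4_smallmedium` (parts (i), (ii)), `Literature.dobner_lemma4_holds : dobner_lemma4`,
   and `Literature.RH.rodgers_tao_holds : RH.rodgers_tao`; also the discharge
   `Literature.NumberTheory.LFunctions.dobner_xiDeformed_approx_holds` of the named fact
   `Literature.NumberTheory.LFunctions.dobner_xiDeformed_approx` (the qualitative Thm. 4 of the source,
   `DobnerNewman.lean`), i.e. Lemma 4 (this file) fed into §4.1 (`DobnerTheorem4Proofs.lean`).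

Consequently (`Literature.NumberTheory.LFunctions.rodgers_tao_of_dobner_lemma4`, `DobnerTheorem4Proofs.lean`) the named fact
`Literature.NumberTheory.LFunctions.rodgers_tao` — the Rodgers–Tao theorem `Λ ≥ 0` (Newman's conjecture,
[RodgersTaoFMP2020, Thm. 1.1]), in the form "for `t < 0`, `H_t` has a non-real zero" — is a
theorem, proved along Dobner's route (A. Dobner, *A proof of Newman's conjecture for the extended
Selberg class*, Acta Arith. 201 (2021), 29–62), all of whose inputs (Lemma 3
`DobnerLemma3Proofs.lean`, Bohr's theorem `BohrAlmostPeriodicProofs.lean`, Thm. 4 from Lemma 4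
`DobnerTheorem4Proofs.lean`, Lemma 4 here) are theorems of this library.

(`rodgers_tao_holds` cannot live in `EquivalentsProofs.lean`, the companion of the file stating
`rodgers_tao`: that file is imported by `NewmanProofs.lean`, which this development imports.)

Two proofs (`dobner_lemma4_large`-adjacent bookkeeping and `dobner_lemma4_smallmedium`) are long
explicit-constant computations and carry raised `maxHeartbeats`.

## References

* [Dobner2021] A. Dobner, Acta Arith. 201 (2021), 29–62 = arXiv:2005.05142, §4 (Lemma 4,
  Lemmas 5–7) and §5.
* [RodgersTaoFMP2020] B. Rodgers, T. Tao, *The de Bruijn–Newman constant is non-negative*,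
  Forum Math. Pi 8 (2020), e6, Thm. 1.1.
-/

noncomputable section

open Complex Filter Topology Set MeasureTheory intervalIntegral

namespace Literature.NumberTheory.LFunctions


/-! ## Part (iii) of Lemma 4: large `n` (contour shift to the steepest-descent abscissa) -/

/-- `w² e^{−w²/τ} ≤ 2τ e^{−w²/(2τ)}` (`x ≤ e^x`). [folklore] -/
theorem sq_mul_exp_neg_sq_div_le {τ : ℝ} (hτ : 0 < τ) (w : ℝ) :
    w ^ 2 * Real.exp (-(w ^ 2 / τ)) ≤ 2 * τ * Real.exp (-(w ^ 2 / (2 * τ))) := by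
  have h1 : w ^ 2 / (2 * τ) ≤ Real.exp (w ^ 2 / (2 * τ)) := by
    linarith [Real.add_one_le_exp (w ^ 2 / (2 * τ))]
  have h2 : w ^ 2 ≤ 2 * τ * Real.exp (w ^ 2 / (2 * τ)) := by
    rw [div_le_iff₀ (by positivity)] at h1; linarith
  have e : Real.exp (-(w ^ 2 / (2 * τ))) = Real.exp (w ^ 2 / (2 * τ)) * Real.exp (-(w ^ 2 / τ)) := by
    rw [← Real.exp_add]; congr 1; field_simp; ring
  rw [e, ← mul_assoc]
  exact mul_le_mul_of_nonneg_right h2 (Real.exp_pos _).le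

/-- `(P + |w|)² e^{−w²/τ} ≤ (2P² + 4τ) e^{−w²/(2τ)}`. [folklore] -/
theorem sq_add_abs_mul_exp_le {τ : ℝ} (hτ : 0 < τ) (P w : ℝ) :
    (P + |w|) ^ 2 * Real.exp (-(w ^ 2 / τ)) ≤ (2 * P ^ 2 + 4 * τ) * Real.exp (-(w ^ 2 / (2 * τ))) := by
  have h1 : (P + |w|) ^ 2 ≤ 2 * P ^ 2 + 2 * w ^ 2 := by
    nlinarith [sq_abs w, sq_nonneg (P - |w|)]
  have h2 : Real.exp (-(w ^ 2 / τ)) ≤ Real.exp (-(w ^ 2 / (2 * τ))) := by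
    rw [Real.exp_le_exp, neg_le_neg_iff]
    exact div_le_div_of_nonneg_left (sq_nonneg w) hτ (by linarith)
  have h3 := sq_mul_exp_neg_sq_div_le hτ w
  have h0 : 0 ≤ Real.exp (-(w ^ 2 / τ)) := (Real.exp_pos _).le
  calc (P + |w|) ^ 2 * Real.exp (-(w ^ 2 / τ))
      ≤ (2 * P ^ 2 + 2 * w ^ 2) * Real.exp (-(w ^ 2 / τ)) := mul_le_mul_of_nonneg_right h1 h0
    _ = 2 * P ^ 2 * Real.exp (-(w ^ 2 / τ)) + 2 * (w ^ 2 * Real.exp (-(w ^ 2 / τ))) := by ring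
    _ ≤ 2 * P ^ 2 * Real.exp (-(w ^ 2 / (2 * τ))) + 2 * (2 * τ * Real.exp (-(w ^ 2 / (2 * τ)))) := by
        gcongr
    _ = (2 * P ^ 2 + 4 * τ) * Real.exp (-(w ^ 2 / (2 * τ))) := by ring

/-- `∫ e^{−(v − m)²/(2τ)} dv = √(2πτ)`. [folklore] -/
theorem integral_exp_neg_sq_sub_div (m : ℝ) {τ : ℝ} (hτ : 0 < τ) :
    ∫ v : ℝ, Real.exp (-((v - m) ^ 2 / (2 * τ))) = Real.sqrt (2 * Real.pi * τ) := by
  have h := integral_sub_right_eq_self (μ := (volume : Measure ℝ))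
    (fun w : ℝ ↦ Real.exp (-((w) ^ 2 / (2 * τ)))) m
  rw [h]
  have := integral_gaussian (1 / (2 * τ))
  have e : (fun x : ℝ ↦ Real.exp (-(1 / (2 * τ)) * x ^ 2)) = fun w ↦ Real.exp (-(w ^ 2 / (2 * τ))) := by
    funext w; congr 1; field_simp
  rw [e] at this
  rw [this]
  congr 1
  field_simp

/-- Integrability of the shifted Gaussian. [folklore] -/
theorem integrable_exp_neg_sq_sub_div (m : ℝ) {τ : ℝ} (hτ : 0 < τ) :
    Integrable fun v : ℝ ↦ Real.exp (-((v - m) ^ 2 / (2 * τ))) := by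
  have h := (integrable_exp_neg_mul_sq (show 0 < 1 / (2 * τ) by positivity)).comp_sub_right m
  refine h.congr (Eventually.of_forall fun v ↦ ?_)
  simp only
  congr 1; field_simp

set_option maxHeartbeats 400000 in
/-- **Dobner's Lemma 4 (iii)** (large `n`): for `t < 0` and `C > 0` there is `y₀` such that for
`|Re s| ≤ C (Im s)^{1/4}`, `Im s ≥ y₀`, `n ≥ 1` with `log n > (Im s)^{3/5}/|t|`:
`‖B_{t,n}(s)‖ ≤ e^{−(|t|/10) log² n}`. [cite: Dobner2021, Lemma 4 (iii)] -/
theorem dobner_lemma4_large {t : ℝ} (ht : t < 0) (C : ℝ) :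
    ∃ y₀ : ℝ, ∀ s : ℂ, |s.re| ≤ C * s.im ^ (1 / 4 : ℝ) → y₀ ≤ s.im → ∀ n : ℕ, 1 ≤ n →
      s.im ^ (3 / 5 : ℝ) / |t| < Real.log n →
        ‖dobnerB t n s‖ ≤ Real.exp (-(|t| / 10) * Real.log n ^ 2) := by
  have ht0 : t ≠ 0 := ht.ne
  have hτ : 0 < |t| := abs_pos.2 ht0
  set τ : ℝ := |t| with hτdef
  have hpi := Real.pi_gt_three
  have hpi4 := Real.pi_le_four
  -- Step 0: conditions on `L = |t| log n`
  have hevL : ∀ᶠ L : ℝ in atTop, 10 ≤ L ∧ 1 + τ ≤ L ∧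
      60 * τ * Real.log (22 * Real.sqrt 2) ≤ L ^ (2 : ℝ) ∧
      60 * τ * (10 / 3) * Real.log L ≤ L ^ (2 : ℝ) ∧
      60 * τ * (3 / 10) * L ^ (1 : ℝ) * Real.log L ≤ L ^ (2 : ℝ) := by
    filter_upwards [eventually_ge_atTop (10 : ℝ), eventually_ge_atTop (1 + τ),
      eventually_const_le_rpow (60 * τ * Real.log (22 * Real.sqrt 2)) (by norm_num : (0 : ℝ) < 2),
      eventually_const_mul_log_le_rpow (60 * τ * (10 / 3)) (by norm_num : (0 : ℝ) < 2),
      eventually_const_mul_rpow_mul_log_le_rpow (60 * τ * (3 / 10)) (by norm_num : (1 : ℝ) < 2)]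
      with L h1 h2 h3 h4 h5
    exact ⟨h1, h2, h3, h4, h5⟩
  obtain ⟨L₀, hL₀⟩ := eventually_atTop.1 hevL
  -- Step 1: conditions on `y = Im s`
  have hevy : ∀ᶠ y : ℝ in atTop, 2 * Real.pi ≤ y ∧ C * y ^ (1 / 4 : ℝ) ≤ y ∧
      C * y ^ (1 / 4 : ℝ) + τ / 4 * Real.log y ≤ y ^ (3 / 5 : ℝ) / 10 ∧ L₀ ≤ y ^ (3 / 5 : ℝ) := by
    have e2 := eventually_const_mul_rpow_le_rpow C (by norm_num : (1 / 4 : ℝ) < 1)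
    have e3 := eventually_const_mul_rpow_le_rpow (20 * C) (by norm_num : (1 / 4 : ℝ) < 3 / 5)
    have e4 := eventually_const_mul_log_le_rpow (20 * (τ / 4)) (by norm_num : (0 : ℝ) < 3 / 5)
    have e5 := eventually_const_le_rpow L₀ (by norm_num : (0 : ℝ) < 3 / 5)
    filter_upwards [eventually_ge_atTop (2 * Real.pi), e2, e3, e4, e5] with y h1 h2 h3 h4 h5
    rw [Real.rpow_one] at h2
    exact ⟨h1, h2, by linarith, h5⟩
  obtain ⟨y₀, hy₀⟩ := eventually_atTop.1 hevy
  refine ⟨y₀, fun s hx hy n hn hℓ ↦ ?_⟩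
  obtain ⟨hy2pi, hxy, hReJ0, hL0y⟩ := hy₀ s.im hy
  -- Step 2: notation and basic sizes
  set y : ℝ := s.im with hydef
  set x : ℝ := s.re with hxdef
  set ℓ : ℝ := Real.log n with hℓdef
  set L : ℝ := τ * ℓ with hLdef
  set J : ℂ := dobnerJ t s with hJdef
  have hy0 : 0 < y := by linarith
  have hℓ0 : 0 ≤ ℓ := Real.log_natCast_nonneg n
  have hyL : y ^ (3 / 5 : ℝ) < L := by
    rw [hLdef]; rwa [div_lt_iff₀ hτ, mul_comm] at hℓ
  have hL0 : L₀ ≤ L := hL0y.trans hyL.le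
  obtain ⟨hL10, hL1τ, hc1, hc2, hc3⟩ := hL₀ L hL0
  have hL1 : 1 ≤ L := by linarith
  have hLpos : 0 < L := by linarith
  have hℓpos : 0 < ℓ := by
    rw [hLdef] at hLpos; exact pos_of_mul_pos_right hLpos hτ.le
  -- `|Re J| ≤ L/10`
  have hxabs : |x| ≤ y := hx.trans hxy
  have hJre : |J.re| ≤ L / 10 := by
    have h1 := abs_dobnerJ_re_sub_re_le t (s := s) hy2pi hxabs
    rw [← hJdef, ← hxdef, ← hydef] at h1
    have : |J.re| ≤ |x| + τ / 4 * Real.log y := by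
      calc |J.re| = |(J.re - x) + x| := by ring_nf
        _ ≤ |J.re - x| + |x| := abs_add_le _ _
        _ ≤ τ / 4 * Real.log y + |x| := by linarith
        _ = |x| + τ / 4 * Real.log y := by ring
    linarith
  -- `Im J ∈ [y, y + τ]`
  have hJim := dobnerJ_im_mem t (s := s) hy0
  rw [← hJdef, ← hydef] at hJim
  have hJim1 : 0 < J.im := by linarith [hJim.1]
  have hJim2 : J.im ≤ y + τ := by
    have h := mul_le_mul_of_nonneg_right hpi4 hτ.le
    rw [← hτdef] at hJim; linarith [hJim.2]
  -- `y ≤ L^{5/3}`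
  have hyL' : y ≤ L ^ (5 / 3 : ℝ) := by
    have h1 : (y ^ (3 / 5 : ℝ)) ^ (5 / 3 : ℝ) ≤ L ^ (5 / 3 : ℝ) :=
      Real.rpow_le_rpow (Real.rpow_nonneg hy0.le _) hyL.le (by norm_num)
    rwa [← Real.rpow_mul hy0.le, show (3 / 5 : ℝ) * (5 / 3) = 1 by norm_num, Real.rpow_one] at h1
  -- Step 3: the abscissa `σ = Re J + L/2` and the line shift
  set σ : ℝ := J.re + L / 2 with hσdef
  have hσ1 : 2 * L / 5 ≤ σ := by linarith [neg_abs_le J.re, (abs_le.1 hJre).1]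
  have hσ2 : σ ≤ 3 * L / 5 := by linarith [(abs_le.1 hJre).2]
  have hσ4 : 4 ≤ σ := by linarith
  have hσ0 : 0 < σ := by linarith
  have hshift : ∫ v : ℝ, dobnerI t n s (2 + v * I) = ∫ v : ℝ, dobnerI t n s (σ + v * I) := by
    simpa using integral_dobnerI_vertical_eq ht0 hn s (by norm_num : (0 : ℝ) < 2)
      (by linarith : (2 : ℝ) ≤ σ)
  -- Step 4: pointwise bound on the new line and integration
  set P : ℝ := σ + 1 + J.im with hPdef
  have hP0 : 0 ≤ P := by rw [hPdef]; linarith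
  set G : ℝ := Real.pi ^ (-σ / 2) * Real.Gamma (σ / 2) * Real.exp (-(3 / 20) * (L * ℓ)) *
    (2 * P ^ 2 + 4 * τ) with hGdef
  have hGamma0 : 0 < Real.Gamma (σ / 2) := Real.Gamma_pos_of_pos (by linarith)
  have hG0 : 0 ≤ G := by rw [hGdef]; positivity
  -- the exponential factor `n^{-σ} e^{(Re J - σ)²/τ} = e^{-(Re J) ℓ - L ℓ /4} ≤ e^{-0.15 L ℓ}`
  have hexpfac : (n : ℝ) ^ (-σ) * Real.exp ((J.re - σ) ^ 2 / τ) ≤ Real.exp (-(3 / 20) * (L * ℓ)) := by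
    have hn0 : (0 : ℝ) < n := by exact_mod_cast hn
    rw [Real.rpow_def_of_pos hn0, ← hℓdef, ← Real.exp_add, Real.exp_le_exp]
    have e1 : (J.re - σ) ^ 2 / τ = L * ℓ / 4 := by
      rw [hσdef, hLdef]; field_simp; ring
    rw [e1]
    have : -(J.re) * ℓ ≤ L / 10 * ℓ := by
      exact mul_le_mul_of_nonneg_right (by linarith [neg_abs_le J.re, (abs_le.1 hJre).1]) hℓ0
    have e2 : ℓ * -σ = -(J.re) * ℓ - L * ℓ / 2 := by rw [hσdef]; ring
    rw [e2]
    linarith [this]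
  have hpt : ∀ v : ℝ, ‖dobnerI t n s (σ + v * I)‖ ≤ G * Real.exp (-((v - J.im) ^ 2 / (2 * τ))) := by
    intro v
    have h1 := norm_dobnerI_vertical_le t hn s hσ0 v
    rw [← hJdef] at h1
    have h2 : (σ + 1 + |v|) ^ 2 * Real.exp (-((J.im - v) ^ 2 / τ)) ≤
        (2 * P ^ 2 + 4 * τ) * Real.exp (-((v - J.im) ^ 2 / (2 * τ))) := by
      have hv : |v| ≤ J.im + |v - J.im| := by
        calc |v| = |J.im + (v - J.im)| := by ring_nf
          _ ≤ |J.im| + |v - J.im| := abs_add_le _ _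
          _ = J.im + |v - J.im| := by rw [abs_of_pos hJim1]
      have h3 : (σ + 1 + |v|) ^ 2 ≤ (P + |v - J.im|) ^ 2 := by
        have : 0 ≤ σ + 1 + |v| := by positivity
        exact pow_le_pow_left₀ this (by rw [hPdef]; linarith) 2
      have e : (J.im - v) ^ 2 = (v - J.im) ^ 2 := by ring
      rw [e]
      exact (mul_le_mul_of_nonneg_right h3 (Real.exp_pos _).le).trans (sq_add_abs_mul_exp_le hτ P _)
    calc ‖dobnerI t n s (σ + v * I)‖
        ≤ Real.pi ^ (-σ / 2) * Real.Gamma (σ / 2) * (σ + 1 + |v|) ^ 2 * (n : ℝ) ^ (-σ) *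
            Real.exp ((J.re - σ) ^ 2 / τ) * Real.exp (-((J.im - v) ^ 2 / τ)) := h1
      _ = Real.pi ^ (-σ / 2) * Real.Gamma (σ / 2) * ((n : ℝ) ^ (-σ) * Real.exp ((J.re - σ) ^ 2 / τ)) *
            ((σ + 1 + |v|) ^ 2 * Real.exp (-((J.im - v) ^ 2 / τ))) := by ring
      _ ≤ Real.pi ^ (-σ / 2) * Real.Gamma (σ / 2) * Real.exp (-(3 / 20) * (L * ℓ)) *
            ((2 * P ^ 2 + 4 * τ) * Real.exp (-((v - J.im) ^ 2 / (2 * τ)))) := by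
          gcongr
      _ = G * Real.exp (-((v - J.im) ^ 2 / (2 * τ))) := by rw [hGdef]; ring
  have hint : ‖∫ v : ℝ, dobnerI t n s (σ + v * I)‖ ≤ G * Real.sqrt (2 * Real.pi * τ) := by
    have h1 := norm_integral_le_of_norm_le ((integrable_exp_neg_sq_sub_div J.im hτ).const_mul G)
      (Eventually.of_forall hpt)
    rwa [MeasureTheory.integral_const_mul, integral_exp_neg_sq_sub_div J.im hτ] at h1
  -- Step 5: `‖B‖ ≤ √2 G' ≤ e^{-L ℓ/10}`
  have hB : ‖dobnerB t n s‖ ≤ Real.sqrt 2 * (Real.Gamma (σ / 2) * (2 * P ^ 2 + 4 * τ)) *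
      Real.exp (-(3 / 20) * (L * ℓ)) := by
    rw [dobnerB_eq_integral_dobnerI, hshift, norm_mul, Complex.norm_real, Real.norm_eq_abs,
      abs_of_pos (by positivity)]
    have hc : 1 / Real.sqrt (Real.pi * τ) * (G * Real.sqrt (2 * Real.pi * τ)) = Real.sqrt 2 * G := by
      have : Real.sqrt (2 * Real.pi * τ) = Real.sqrt 2 * Real.sqrt (Real.pi * τ) := by
        rw [← Real.sqrt_mul (by norm_num : (0:ℝ) ≤ 2)]; ring_nf
      rw [this]; field_simp
    have hpi1 : Real.pi ^ (-σ / 2) ≤ 1 :=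
      Real.rpow_le_one_of_one_le_of_nonpos (by linarith) (by linarith)
    calc 1 / Real.sqrt (Real.pi * τ) * ‖∫ v : ℝ, dobnerI t n s (σ + v * I)‖
        ≤ 1 / Real.sqrt (Real.pi * τ) * (G * Real.sqrt (2 * Real.pi * τ)) :=
          mul_le_mul_of_nonneg_left hint (by positivity)
      _ = Real.sqrt 2 * G := hc
      _ = Real.sqrt 2 * (Real.pi ^ (-σ / 2) * (Real.Gamma (σ / 2) * (2 * P ^ 2 + 4 * τ))) *
            Real.exp (-(3 / 20) * (L * ℓ)) := by rw [hGdef]; ring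
      _ ≤ Real.sqrt 2 * (1 * (Real.Gamma (σ / 2) * (2 * P ^ 2 + 4 * τ))) *
            Real.exp (-(3 / 20) * (L * ℓ)) := by gcongr
      _ = _ := by ring
  -- the numerical absorption `√2 Γ(σ/2) (2P²+4τ) ≤ e^{L ℓ / 20}`
  have hGam : Real.Gamma (σ / 2) ≤ Real.exp (3 / 10 * L * Real.log L) := by
    set R : ℝ := 3 / 10 * L with hR
    have hR2 : 2 ≤ R := by rw [hR]; linarith
    have hR1 : 1 ≤ R := by linarith
    have hsR : σ / 2 ≤ R := by rw [hR]; linarith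
    have hs1 : 1 ≤ σ / 2 := by linarith
    calc Real.Gamma (σ / 2) ≤ (σ / 2) ^ (σ / 2) := Real.Gamma_le_rpow_self hs1
      _ ≤ R ^ (σ / 2) := Real.rpow_le_rpow (by linarith) hsR (by linarith)
      _ ≤ R ^ R := Real.rpow_le_rpow_of_exponent_le hR1 hsR
      _ = Real.exp (Real.log R * R) := Real.rpow_def_of_pos (by linarith) R
      _ ≤ Real.exp (3 / 10 * L * Real.log L) := by
          rw [Real.exp_le_exp]
          have hlogR : Real.log R ≤ Real.log L := Real.log_le_log (by linarith) (by rw [hR]; linarith)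
          have hR0 : 0 ≤ R := by linarith
          calc Real.log R * R = R * Real.log R := mul_comm _ _
            _ ≤ R * Real.log L := mul_le_mul_of_nonneg_left hlogR hR0
            _ = 3 / 10 * L * Real.log L := by rw [hR]
  have hPbd : 2 * P ^ 2 + 4 * τ ≤ 22 * L ^ (10 / 3 : ℝ) := by
    have hL53 : L ≤ L ^ (5 / 3 : ℝ) := by
      conv_lhs => rw [← Real.rpow_one L]
      exact Real.rpow_le_rpow_of_exponent_le hL1 (by norm_num)
    have hP3 : P ≤ 3 * L ^ (5 / 3 : ℝ) := by
      have : P ≤ L ^ (5 / 3 : ℝ) + 2 * L := by rw [hPdef]; linarith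
      linarith
    have hsq : (L ^ (5 / 3 : ℝ)) ^ 2 = L ^ (10 / 3 : ℝ) := by
      rw [← Real.rpow_natCast, ← Real.rpow_mul hLpos.le]; norm_num
    have hL103 : L ≤ L ^ (10 / 3 : ℝ) := by
      conv_lhs => rw [← Real.rpow_one L]
      exact Real.rpow_le_rpow_of_exponent_le hL1 (by norm_num)
    have hP2 : P ^ 2 ≤ (3 * L ^ (5 / 3 : ℝ)) ^ 2 := pow_le_pow_left₀ hP0 hP3 2
    have e9 : (3 * L ^ (5 / 3 : ℝ)) ^ 2 = 9 * L ^ (10 / 3 : ℝ) := by rw [mul_pow, hsq]; norm_num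
    rw [e9] at hP2
    have hτL : τ ≤ L ^ (10 / 3 : ℝ) := by linarith
    linarith
  have hfinal : Real.sqrt 2 * (Real.Gamma (σ / 2) * (2 * P ^ 2 + 4 * τ)) ≤
      Real.exp (1 / 20 * (L * ℓ)) := by
    have h22 : (0 : ℝ) < 22 * Real.sqrt 2 := by positivity
    have hLpow : L ^ (10 / 3 : ℝ) = Real.exp (10 / 3 * Real.log L) := by
      rw [Real.rpow_def_of_pos hLpos]; ring_nf
    calc Real.sqrt 2 * (Real.Gamma (σ / 2) * (2 * P ^ 2 + 4 * τ))
        ≤ Real.sqrt 2 * (Real.exp (3 / 10 * L * Real.log L) * (22 * L ^ (10 / 3 : ℝ))) := by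
          gcongr
      _ = (22 * Real.sqrt 2) * L ^ (10 / 3 : ℝ) * Real.exp (3 / 10 * L * Real.log L) := by ring
      _ = Real.exp (Real.log (22 * Real.sqrt 2) + 10 / 3 * Real.log L + 3 / 10 * L * Real.log L) := by
          rw [Real.exp_add, Real.exp_add, Real.exp_log h22, hLpow]
      _ ≤ Real.exp (1 / 20 * (L * ℓ)) := by
          rw [Real.exp_le_exp]
          have e : L * ℓ = L ^ (2 : ℝ) / τ := by
            rw [show (2 : ℝ) = ((2 : ℕ) : ℝ) by norm_num, Real.rpow_natCast, hLdef]
            field_simp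
          rw [e]
          rw [Real.rpow_one] at hc3
          have hτ60 : 0 < 60 * τ := by positivity
          -- each of the three terms is `≤ L²/(60 τ)`
          have i1 : Real.log (22 * Real.sqrt 2) ≤ L ^ (2 : ℝ) / (60 * τ) := by
            rw [le_div_iff₀ hτ60]; linarith
          have i2 : 10 / 3 * Real.log L ≤ L ^ (2 : ℝ) / (60 * τ) := by
            rw [le_div_iff₀ hτ60]; linarith
          have i3 : 3 / 10 * L * Real.log L ≤ L ^ (2 : ℝ) / (60 * τ) := by
            rw [le_div_iff₀ hτ60]; linarith
          have : L ^ (2 : ℝ) / (60 * τ) * 3 = 1 / 20 * (L ^ (2 : ℝ) / τ) := by field_simp; ring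
          linarith
  calc ‖dobnerB t n s‖
      ≤ Real.sqrt 2 * (Real.Gamma (σ / 2) * (2 * P ^ 2 + 4 * τ)) * Real.exp (-(3 / 20) * (L * ℓ)) := hB
    _ ≤ Real.exp (1 / 20 * (L * ℓ)) * Real.exp (-(3 / 20) * (L * ℓ)) :=
        mul_le_mul_of_nonneg_right hfinal (Real.exp_pos _).le
    _ = Real.exp (-(|t| / 10) * Real.log n ^ 2) := by
        rw [← Real.exp_add]; congr 1; rw [hLdef, hℓdef]; ring


/-! ## Parts (i)/(ii), step 1: the rectangle contour and the four minor pieces `V₁, V₂, H₁, H₂` -/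

/-! ## The contour identity -/

/-- **The contour shift** (Cauchy's theorem on the rectangle `[2, Re c] × [Im c − Y, Im c + Y]`,
which lies in the upper half-plane where `𝓘` is holomorphic): for `n ≥ 1`, `Y > 0` and
`Im c − Y > 0`,
`∫ 𝓘(2+iv) dv = (∫ 𝓘(2+iv) dv − ∫_{Im c−Y}^{Im c+Y} 𝓘(2+iv) dv) + ∫_{−Y}^{Y} 𝓘(c+iu) du
 − i (∫_2^{Re c} 𝓘(r + i(Im c−Y)) dr − ∫_2^{Re c} 𝓘(r + i(Im c+Y)) dr)`.
[cite: Dobner2021, proof of Lemma 4 (Cauchy's theorem display, p. 11)] -/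
theorem integral_dobnerI_two_eq (t : ℝ) {n : ℕ} (hn : 1 ≤ n) (s c : ℂ) {Y : ℝ} (hY : 0 < Y)
    (hc : 0 < c.im - Y) :
    ∫ v : ℝ, dobnerI t n s (2 + v * I) =
      ((∫ v : ℝ, dobnerI t n s (2 + v * I)) -
          ∫ v in (c.im - Y)..(c.im + Y), dobnerI t n s (2 + v * I)) +
        (∫ u in (-Y)..Y, dobnerI t n s (c + u * I)) -
        I * ((∫ r in (2 : ℝ)..c.re, dobnerI t n s (r + ((c.im - Y : ℝ) : ℂ) * I)) -
          ∫ r in (2 : ℝ)..c.re, dobnerI t n s (r + ((c.im + Y : ℝ) : ℂ) * I)) := by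
  set F := dobnerI t n s with hF
  -- Cauchy on the rectangle
  have hdiff : DifferentiableOn ℂ F (Set.uIcc (2 : ℝ) c.re ×ℂ Set.uIcc (c.im - Y) (c.im + Y)) := by
    refine (differentiableOn_dobnerI t hn s).mono fun z hz ↦ Or.inr ?_
    have h2 : z.im ∈ Set.uIcc (c.im - Y) (c.im + Y) := hz.2
    rw [Set.uIcc_of_le (by linarith)] at h2
    exact (hc.trans_le h2.1).ne'
  have hrect := Complex.integral_boundary_rect_eq_zero_of_differentiableOn F ⟨2, c.im - Y⟩
    ⟨c.re, c.im + Y⟩ hdiff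
  change (∫ x : ℝ in (2 : ℝ)..c.re, F (x + ((c.im - Y : ℝ) : ℂ) * I)) -
      (∫ x : ℝ in (2 : ℝ)..c.re, F (x + ((c.im + Y : ℝ) : ℂ) * I)) +
      I • (∫ y : ℝ in (c.im - Y)..(c.im + Y), F (((c.re : ℝ) : ℂ) + y * I)) -
      I • (∫ y : ℝ in (c.im - Y)..(c.im + Y), F ((((2 : ℝ) : ℝ) : ℂ) + y * I)) = 0 at hrect
  simp only [Complex.ofReal_ofNat, smul_eq_mul] at hrect
  -- the middle vertical piece is `∫_{-Y}^{Y} F(c + iu) du`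
  have hM : ∫ y : ℝ in (c.im - Y)..(c.im + Y), F ((c.re : ℂ) + y * I) =
      ∫ u in (-Y)..Y, F (c + u * I) := by
    have h := intervalIntegral.integral_comp_add_right (a := -Y) (b := Y)
      (fun y : ℝ ↦ F ((c.re : ℂ) + y * I)) c.im
    rw [show -Y + c.im = c.im - Y by ring, show Y + c.im = c.im + Y by ring] at h
    rw [← h]
    congr 1; funext u
    congr 1
    apply Complex.ext <;> simp [add_comm]
  rw [hM] at hrect
  set V := ∫ y : ℝ in (c.im - Y)..(c.im + Y), F (2 + y * I)
  set M := ∫ u in (-Y)..Y, F (c + u * I)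
  set H1 := ∫ x : ℝ in (2 : ℝ)..c.re, F (x + ((c.im - Y : ℝ) : ℂ) * I)
  set H2 := ∫ x : ℝ in (2 : ℝ)..c.re, F (x + ((c.im + Y : ℝ) : ℂ) * I)
  have hI : I * I = -1 := Complex.I_mul_I
  linear_combination I * hrect + (V - M) * hI

/-- **Tail estimate**: if `‖f v‖ ≤ g v` off `(a, b)` with `g ≥ 0` integrable, then
`‖∫ f − ∫_a^b f‖ ≤ ∫ g`. [folklore] -/
theorem norm_integral_sub_intervalIntegral_le {f : ℝ → ℂ} {g : ℝ → ℝ} {a b : ℝ} (hab : a ≤ b)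
    (hf : Integrable f) (hg : Integrable g) (hbound : ∀ v, v ∉ Set.Ioo a b → ‖f v‖ ≤ g v)
    (hg0 : ∀ v, 0 ≤ g v) :
    ‖(∫ v, f v) - ∫ v in a..b, f v‖ ≤ ∫ v, g v := by
  rw [intervalIntegral.integral_of_le hab, ← MeasureTheory.integral_indicator measurableSet_Ioc,
    ← integral_sub hf (hf.indicator measurableSet_Ioc)]
  refine norm_integral_le_of_norm_le hg (Eventually.of_forall fun v ↦ ?_)
  by_cases hv : v ∈ Set.Ioc a b
  · rw [Set.indicator_of_mem hv, sub_self, norm_zero]; exact hg0 v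
  · rw [Set.indicator_of_notMem hv, sub_zero]
    exact hbound v fun h ↦ hv ⟨h.1, h.2.le⟩

/-! ## Bounds on the four minor pieces (cf. [Dobner2021, Lemma 6]) -/

/-- **The integrand on the horizontal pieces** (cf. [Dobner2021, Lemma 6 (i)]): for `y ≥ 1`,
`|r| ≤ 2y^{3/5}`, `h ≥ 2`, `|r| + h ≤ 3y`, `log n ≤ y^{3/5}/|t|`, `|Re J| ≤ y^{3/5}`,
`|Im J − h| ≥ y^{2/3}/2`, `log(2y^{3/5}) ≤ log y` and the numerical largeness condition `hcond`:
`‖𝓘(r + ih)‖ ≤ e^{−y^{4/3}/(5|t|)}` (`‖γ‖` via `Literature.NumberTheory.LFunctions.norm_xiGammaFactor_le_of_im`, `n^{−r} ≤ e^{2y^{6/5}/|t|}`,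
`Re((J − z)²) ≤ 9y^{6/5} − y^{4/3}/4`). [cite: Dobner2021, Lemma 6 (i)] -/
theorem norm_dobnerI_horizontal_le {t : ℝ} (ht : t ≠ 0) {n : ℕ} (hn : 1 ≤ n) (s : ℂ)
    {y r h : ℝ} (hy : 1 ≤ y) (hr : |r| ≤ 2 * y ^ (3 / 5 : ℝ)) (hR2 : 1 ≤ y ^ (3 / 5 : ℝ))
    (hh2 : 2 ≤ h) (hzle : |r| + h ≤ 3 * y)
    (hℓ : Real.log n ≤ y ^ (3 / 5 : ℝ) / |t|) (hJre : |(dobnerJ t s).re| ≤ y ^ (3 / 5 : ℝ))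
    (hJim : y ^ (2 / 3 : ℝ) / 2 ≤ |(dobnerJ t s).im - h|)
    (hylog : Real.log (2 * y ^ (3 / 5 : ℝ)) ≤ Real.log y)
    (hcond : Real.log 16 + 2 * Real.log y + 3 * y ^ (3 / 5 : ℝ) +
      2 * y ^ (3 / 5 : ℝ) * Real.log y + 11 * y ^ (6 / 5 : ℝ) / |t| ≤ y ^ (4 / 3 : ℝ) / (20 * |t|)) :
    ‖dobnerI t n s (r + h * I)‖ ≤ Real.exp (-(y ^ (4 / 3 : ℝ) / (5 * |t|))) := by
  have ht' : 0 < |t| := abs_pos.2 ht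
  have hpi := Real.pi_gt_three
  have hy0 : 0 < y := by linarith
  set J := dobnerJ t s with hJ
  set R : ℝ := 2 * y ^ (3 / 5 : ℝ) with hRdef
  have hR2' : 2 ≤ R := by rw [hRdef]; linarith
  have hR0 : 0 < R := by linarith
  set z : ℂ := r + h * I with hz
  have hzre : z.re = r := by simp [hz]
  have hzim : z.im = h := by simp [hz]
  rw [norm_dobnerI t hn, hzre, hzim]
  -- `‖γ(z)‖ ≤ 16 y² π^{R/2} R^R`
  have hγ : ‖xiGammaFactor z‖ ≤ 16 * y ^ 2 * Real.pi ^ (R / 2) * R ^ R := by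
    have h1 := norm_xiGammaFactor_le_of_im (z := z) (R := R) (by rw [hzim]; exact hh2)
      (by rw [hzre]; exact hr) hR2'
    have hnz : ‖z‖ ≤ |r| + h := by
      calc ‖z‖ ≤ |z.re| + |z.im| := Complex.norm_le_abs_re_add_abs_im z
        _ = |r| + h := by rw [hzre, hzim, abs_of_pos (show (0 : ℝ) < h by linarith)]
    have h2 : (‖z‖ + 1) ^ 2 ≤ 16 * y ^ 2 := by
      have : ‖z‖ + 1 ≤ 4 * y := by linarith
      nlinarith [norm_nonneg z]
    have h3 : 0 ≤ Real.pi ^ (R / 2) * R ^ R :=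
      mul_nonneg (Real.rpow_nonneg Real.pi_pos.le _) (Real.rpow_nonneg hR0.le _)
    calc ‖xiGammaFactor z‖ ≤ (‖z‖ + 1) ^ 2 * Real.pi ^ (R / 2) * R ^ R := h1
      _ = (‖z‖ + 1) ^ 2 * (Real.pi ^ (R / 2) * R ^ R) := by ring
      _ ≤ 16 * y ^ 2 * (Real.pi ^ (R / 2) * R ^ R) := mul_le_mul_of_nonneg_right h2 h3
      _ = _ := by ring
  -- in exponential form: `16 y² π^{R/2} R^R ≤ exp(log 16 + 2 log y + 3 y^{3/5} + 2 y^{3/5} log y)`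
  have hγ' : 16 * y ^ 2 * Real.pi ^ (R / 2) * R ^ R ≤
      Real.exp (Real.log 16 + 2 * Real.log y + 3 * y ^ (3 / 5 : ℝ) + 2 * y ^ (3 / 5 : ℝ) * Real.log y) := by
    have e1 : (16 : ℝ) * y ^ 2 = Real.exp (Real.log 16 + 2 * Real.log y) := by
      rw [Real.exp_add, Real.exp_log (by norm_num), show 2 * Real.log y = Real.log (y ^ 2) by
        rw [Real.log_pow]; norm_num, Real.exp_log (by positivity)]
    have e2 : Real.pi ^ (R / 2) ≤ Real.exp (3 * y ^ (3 / 5 : ℝ)) := by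
      rw [Real.rpow_def_of_pos Real.pi_pos, Real.exp_le_exp]
      have hlpi : Real.log Real.pi ≤ 3 := by
        have := Real.log_le_sub_one_of_pos Real.pi_pos; linarith [Real.pi_le_four]
      have : Real.log Real.pi * (R / 2) ≤ 3 * (R / 2) :=
        mul_le_mul_of_nonneg_right hlpi (by linarith)
      rw [hRdef] at this ⊢; linarith
    have e3 : R ^ R ≤ Real.exp (2 * y ^ (3 / 5 : ℝ) * Real.log y) := by
      rw [Real.rpow_def_of_pos hR0, Real.exp_le_exp]
      calc Real.log R * R = R * Real.log R := mul_comm _ _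
        _ ≤ R * Real.log y := mul_le_mul_of_nonneg_left hylog hR0.le
        _ = 2 * y ^ (3 / 5 : ℝ) * Real.log y := by rw [hRdef]
    calc 16 * y ^ 2 * Real.pi ^ (R / 2) * R ^ R
        ≤ Real.exp (Real.log 16 + 2 * Real.log y) * Real.exp (3 * y ^ (3 / 5 : ℝ)) *
            Real.exp (2 * y ^ (3 / 5 : ℝ) * Real.log y) := by
          rw [e1]; gcongr
      _ = _ := by rw [← Real.exp_add, ← Real.exp_add]
  -- `n^{-r} ≤ exp(2 y^{6/5}/|t|)`
  have hnr : (n : ℝ) ^ (-r) ≤ Real.exp (2 * y ^ (6 / 5 : ℝ) / |t|) := by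
    have hn0 : (0 : ℝ) < n := by exact_mod_cast hn
    rw [Real.rpow_def_of_pos hn0, Real.exp_le_exp]
    have hℓ0 : 0 ≤ Real.log n := Real.log_natCast_nonneg n
    have h65 : y ^ (3 / 5 : ℝ) * y ^ (3 / 5 : ℝ) = y ^ (6 / 5 : ℝ) := by
      rw [← Real.rpow_add hy0]; norm_num
    calc Real.log n * -r ≤ Real.log n * |r| := by
          exact mul_le_mul_of_nonneg_left (neg_le_abs r) hℓ0
      _ ≤ (y ^ (3 / 5 : ℝ) / |t|) * (2 * y ^ (3 / 5 : ℝ)) :=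
          mul_le_mul hℓ hr (abs_nonneg r) (by positivity)
      _ = 2 * y ^ (6 / 5 : ℝ) / |t| := by rw [← h65]; field_simp
  -- the Gaussian: `((Re J − r)² − (Im J − h)²)/|t| ≤ (9 y^{6/5} − y^{4/3}/4)/|t|`
  have hgauss : ((J.re - r) ^ 2 - (J.im - h) ^ 2) / |t| ≤
      (9 * y ^ (6 / 5 : ℝ) - y ^ (4 / 3 : ℝ) / 4) / |t| := by
    refine div_le_div_of_nonneg_right ?_ ht'.le
    have h1 : |J.re - r| ≤ 3 * y ^ (3 / 5 : ℝ) := by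
      calc |J.re - r| ≤ |J.re| + |r| := abs_sub _ _
        _ ≤ y ^ (3 / 5 : ℝ) + 2 * y ^ (3 / 5 : ℝ) := add_le_add hJre hr
        _ = 3 * y ^ (3 / 5 : ℝ) := by ring
    have h2 : (J.re - r) ^ 2 ≤ 9 * y ^ (6 / 5 : ℝ) := by
      have h65 : y ^ (3 / 5 : ℝ) * y ^ (3 / 5 : ℝ) = y ^ (6 / 5 : ℝ) := by
        rw [← Real.rpow_add hy0]; norm_num
      calc (J.re - r) ^ 2 = |J.re - r| ^ 2 := (sq_abs _).symm
        _ ≤ (3 * y ^ (3 / 5 : ℝ)) ^ 2 := pow_le_pow_left₀ (abs_nonneg _) h1 2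
        _ = 9 * y ^ (6 / 5 : ℝ) := by rw [← h65]; ring
    have h3 : y ^ (4 / 3 : ℝ) / 4 ≤ (J.im - h) ^ 2 := by
      have h43 : y ^ (2 / 3 : ℝ) * y ^ (2 / 3 : ℝ) = y ^ (4 / 3 : ℝ) := by
        rw [← Real.rpow_add hy0]; norm_num
      calc y ^ (4 / 3 : ℝ) / 4 = (y ^ (2 / 3 : ℝ) / 2) ^ 2 := by rw [← h43]; ring
        _ ≤ |J.im - h| ^ 2 := pow_le_pow_left₀ (by positivity) hJim 2
        _ = (J.im - h) ^ 2 := sq_abs _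
    linarith
  -- assemble
  have hG0 : 0 ≤ ‖xiGammaFactor z‖ := norm_nonneg _
  have hn0' : 0 ≤ (n : ℝ) ^ (-r) := Real.rpow_nonneg n.cast_nonneg _
  calc ‖xiGammaFactor z‖ * (n : ℝ) ^ (-r) * Real.exp (((J.re - r) ^ 2 - (J.im - h) ^ 2) / |t|)
      ≤ Real.exp (Real.log 16 + 2 * Real.log y + 3 * y ^ (3 / 5 : ℝ) + 2 * y ^ (3 / 5 : ℝ) * Real.log y) *
          Real.exp (2 * y ^ (6 / 5 : ℝ) / |t|) *
          Real.exp ((9 * y ^ (6 / 5 : ℝ) - y ^ (4 / 3 : ℝ) / 4) / |t|) := by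
        gcongr
        · exact hγ.trans hγ'
    _ ≤ Real.exp (-(y ^ (4 / 3 : ℝ) / (5 * |t|))) := by
        rw [← Real.exp_add, ← Real.exp_add, Real.exp_le_exp]
        have e : -(y ^ (4 / 3 : ℝ) / (5 * |t|)) =
            y ^ (4 / 3 : ℝ) / (20 * |t|) + (-(y ^ (4 / 3 : ℝ) / 4)) / |t| := by
          field_simp; ring
        rw [e]
        have e2 : (9 * y ^ (6 / 5 : ℝ) - y ^ (4 / 3 : ℝ) / 4) / |t| =
            9 * y ^ (6 / 5 : ℝ) / |t| + (-(y ^ (4 / 3 : ℝ) / 4)) / |t| := by ring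
        rw [e2]
        have e3 : 11 * y ^ (6 / 5 : ℝ) / |t| = 2 * y ^ (6 / 5 : ℝ) / |t| + 9 * y ^ (6 / 5 : ℝ) / |t| := by
          ring
        rw [e3] at hcond
        linarith

/-- **The integrand on the line `Re z = 2` away from the saddle** (cf. [Dobner2021, Lemma 6 (ii)]):
if `|v − Im J| ≥ Y/2` then, with `P = 3 + Im J`,
`‖𝓘(2+iv)‖ ≤ e^{(Re J−2)²/|t|} (2P² + 4|t|) e^{−Y²/(16|t|)} e^{−(v − Im J)²/(4|t|)}`.
[cite: Dobner2021, Lemma 6 (ii)] -/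
theorem norm_dobnerI_two_le {t : ℝ} (ht : t ≠ 0) {n : ℕ} (hn : 1 ≤ n) (s : ℂ) {Y : ℝ} (hY : 0 ≤ Y)
    (v : ℝ) (hJim0 : 0 < (dobnerJ t s).im) (hw : Y / 2 ≤ |v - (dobnerJ t s).im|) :
    ‖dobnerI t n s (2 + v * I)‖ ≤
      Real.exp (((dobnerJ t s).re - 2) ^ 2 / |t|) * (2 * (3 + (dobnerJ t s).im) ^ 2 + 4 * |t|) *
        Real.exp (-(Y ^ 2 / (16 * |t|))) *
        Real.exp (-((v - (dobnerJ t s).im) ^ 2 / (2 * (2 * |t|)))) := by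
  have ht' : 0 < |t| := abs_pos.2 ht
  have hpi := Real.pi_gt_three
  set J := dobnerJ t s with hJ
  set w : ℝ := v - J.im with hwdef
  set P : ℝ := 3 + J.im with hP
  have h1 : ‖dobnerI t n s (2 + v * I)‖ ≤ Real.pi ^ (-(2 : ℝ) / 2) * Real.Gamma (2 / 2) *
      (2 + 1 + |v|) ^ 2 * (n : ℝ) ^ (-(2 : ℝ)) * Real.exp ((J.re - 2) ^ 2 / |t|) *
      Real.exp (-((J.im - v) ^ 2 / |t|)) := by
    have := norm_dobnerI_vertical_le t hn s (σ := 2) (by norm_num) v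
    rw [← hJ] at this
    simpa using this
  have f1 : Real.pi ^ (-(2 : ℝ) / 2) * Real.Gamma (2 / 2) ≤ 1 := by
    rw [show (2 : ℝ) / 2 = 1 by norm_num, Real.Gamma_one, mul_one, show -(2 : ℝ) / 2 = -1 by norm_num,
      Real.rpow_neg_one]
    exact inv_le_one_of_one_le₀ (by linarith)
  have f2 : (n : ℝ) ^ (-(2 : ℝ)) ≤ 1 :=
    Real.rpow_le_one_of_one_le_of_nonpos (by exact_mod_cast hn) (by norm_num)
  have f3 : (2 + 1 + |v|) ^ 2 ≤ (P + |w|) ^ 2 := by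
    have hv : |v| ≤ J.im + |w| := by
      calc |v| = |J.im + w| := by rw [hwdef]; ring_nf
        _ ≤ |J.im| + |w| := abs_add_le _ _
        _ = J.im + |w| := by rw [abs_of_pos hJim0]
    have : 0 ≤ 2 + 1 + |v| := by positivity
    exact pow_le_pow_left₀ this (by rw [hP]; linarith) 2
  have f4 : (P + |w|) ^ 2 * Real.exp (-((J.im - v) ^ 2 / |t|)) ≤
      (2 * P ^ 2 + 4 * |t|) * Real.exp (-(w ^ 2 / (2 * |t|))) := by
    rw [show (J.im - v) ^ 2 = w ^ 2 by rw [hwdef]; ring]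
    exact sq_add_abs_mul_exp_le ht' P w
  have f5 : Real.exp (-(w ^ 2 / (2 * |t|))) ≤
      Real.exp (-(Y ^ 2 / (16 * |t|))) * Real.exp (-(w ^ 2 / (2 * (2 * |t|)))) := by
    rw [← Real.exp_add, Real.exp_le_exp]
    have hw2 : Y ^ 2 / 4 ≤ w ^ 2 := by
      calc Y ^ 2 / 4 = (Y / 2) ^ 2 := by ring
        _ ≤ |w| ^ 2 := pow_le_pow_left₀ (by linarith) hw 2
        _ = w ^ 2 := sq_abs w
    have e : -(w ^ 2 / (2 * |t|)) = -(w ^ 2 / (4 * |t|)) + -(w ^ 2 / (2 * (2 * |t|))) := by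
      field_simp; ring
    rw [e]
    have : Y ^ 2 / (16 * |t|) ≤ w ^ 2 / (4 * |t|) := by
      rw [div_le_div_iff₀ (by positivity) (by positivity)]; nlinarith
    linarith
  have hP0 : 0 ≤ 2 * P ^ 2 + 4 * |t| := by positivity
  calc ‖dobnerI t n s (2 + v * I)‖
      ≤ Real.pi ^ (-(2 : ℝ) / 2) * Real.Gamma (2 / 2) * (2 + 1 + |v|) ^ 2 * (n : ℝ) ^ (-(2 : ℝ)) *
          Real.exp ((J.re - 2) ^ 2 / |t|) * Real.exp (-((J.im - v) ^ 2 / |t|)) := h1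
    _ = (Real.pi ^ (-(2 : ℝ) / 2) * Real.Gamma (2 / 2)) * (n : ℝ) ^ (-(2 : ℝ)) *
          Real.exp ((J.re - 2) ^ 2 / |t|) * ((2 + 1 + |v|) ^ 2 * Real.exp (-((J.im - v) ^ 2 / |t|))) := by
        ring
    _ ≤ 1 * 1 * Real.exp ((J.re - 2) ^ 2 / |t|) *
          ((P + |w|) ^ 2 * Real.exp (-((J.im - v) ^ 2 / |t|))) := by
        gcongr
    _ ≤ 1 * 1 * Real.exp ((J.re - 2) ^ 2 / |t|) *
          ((2 * P ^ 2 + 4 * |t|) * (Real.exp (-(Y ^ 2 / (16 * |t|))) *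
            Real.exp (-(w ^ 2 / (2 * (2 * |t|)))))) := by
        gcongr 1 * 1 * Real.exp ((J.re - 2) ^ 2 / |t|) * ?_
        exact f4.trans (mul_le_mul_of_nonneg_left f5 hP0)
    _ = _ := by rw [hP, hwdef]; ring

/-! ## The main estimate of this file -/

/-- The numerical bookkeeping for `Literature.NumberTheory.LFunctions.dobner_lemma4_contour`: the bounds of the outer and the
horizontal pieces add up to at most `e^{−y^{4/3}/(18τ)}` under the largeness conditions
`hcondO`, `hcondHH`. [folklore] -/
theorem dobner_contour_numerics {τ y Jre P Y cτ : ℝ} (hτ : 0 < τ) (hy : 1 ≤ y) (hcτ : 0 < cτ)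
    (hcsqrt : cτ * Real.sqrt (4 * Real.pi * τ) = 2)
    (hJre : |Jre| ≤ y ^ (3 / 5 : ℝ)) (h2 : 2 ≤ y ^ (3 / 5 : ℝ)) (hP0 : 0 ≤ P) (hP : P ≤ 2 * y)
    (hτy : τ ≤ y) (hY : Y = y ^ (2 / 3 : ℝ))
    (hcondO : Real.log 48 + 2 * Real.log y + 4 * y ^ (6 / 5 : ℝ) / τ ≤ y ^ (4 / 3 : ℝ) / (144 * τ))
    (hcondHH : Real.log (8 * cτ) + 3 / 5 * Real.log y ≤ y ^ (4 / 3 : ℝ) / (10 * τ)) :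
    cτ * (Real.exp ((Jre - 2) ^ 2 / τ) * (2 * P ^ 2 + 4 * τ) * Real.exp (-(Y ^ 2 / (16 * τ))) *
        Real.sqrt (2 * Real.pi * (2 * τ))) +
      cτ * (2 * (2 * y ^ (3 / 5 : ℝ) * Real.exp (-(y ^ (4 / 3 : ℝ) / (5 * τ))))) ≤
      Real.exp (-(y ^ (4 / 3 : ℝ) / (18 * τ))) := by
  have hy0 : 0 < y := by linarith
  have hpi := Real.pi_gt_three
  -- the outer piece
  have f1 : Real.exp ((Jre - 2) ^ 2 / τ) ≤ Real.exp (4 * y ^ (6 / 5 : ℝ) / τ) := by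
    refine Real.exp_le_exp.2 (div_le_div_of_nonneg_right ?_ hτ.le)
    have h1 : |Jre - 2| ≤ 2 * y ^ (3 / 5 : ℝ) := by
      calc |Jre - 2| ≤ |Jre| + |(2 : ℝ)| := abs_sub _ _
        _ ≤ y ^ (3 / 5 : ℝ) + 2 := by rw [abs_two]; linarith
        _ ≤ 2 * y ^ (3 / 5 : ℝ) := by linarith
    have h65 : y ^ (3 / 5 : ℝ) * y ^ (3 / 5 : ℝ) = y ^ (6 / 5 : ℝ) := by
      rw [← Real.rpow_add hy0]; norm_num
    calc (Jre - 2) ^ 2 = |Jre - 2| ^ 2 := (sq_abs _).symm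
      _ ≤ (2 * y ^ (3 / 5 : ℝ)) ^ 2 := pow_le_pow_left₀ (abs_nonneg _) h1 2
      _ = 4 * y ^ (6 / 5 : ℝ) := by rw [← h65]; ring
  have f2 : 2 * P ^ 2 + 4 * τ ≤ 12 * Real.exp (2 * Real.log y) := by
    rw [show 2 * Real.log y = Real.log (y ^ 2) by rw [Real.log_pow]; norm_num,
      Real.exp_log (by positivity)]
    have : P ^ 2 ≤ (2 * y) ^ 2 := pow_le_pow_left₀ hP0 hP 2
    nlinarith
  have f3 : Real.exp (-(Y ^ 2 / (16 * τ))) = Real.exp (-(y ^ (4 / 3 : ℝ) / (16 * τ))) := by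
    rw [hY, ← Real.rpow_natCast, ← Real.rpow_mul hy0.le]; norm_num
  have e1 : Real.sqrt (2 * Real.pi * (2 * τ)) = Real.sqrt (4 * Real.pi * τ) := by ring_nf
  have hErr1 : cτ * (Real.exp ((Jre - 2) ^ 2 / τ) * (2 * P ^ 2 + 4 * τ) *
      Real.exp (-(Y ^ 2 / (16 * τ))) * Real.sqrt (2 * Real.pi * (2 * τ))) ≤
      1 / 2 * Real.exp (-(y ^ (4 / 3 : ℝ) / (18 * τ))) := by
    rw [e1, f3]
    have hP2 : 0 ≤ 2 * P ^ 2 + 4 * τ := by positivity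
    calc cτ * (Real.exp ((Jre - 2) ^ 2 / τ) * (2 * P ^ 2 + 4 * τ) *
          Real.exp (-(y ^ (4 / 3 : ℝ) / (16 * τ))) * Real.sqrt (4 * Real.pi * τ))
        ≤ cτ * (Real.exp (4 * y ^ (6 / 5 : ℝ) / τ) * (12 * Real.exp (2 * Real.log y)) *
          Real.exp (-(y ^ (4 / 3 : ℝ) / (16 * τ))) * Real.sqrt (4 * Real.pi * τ)) := by
          gcongr
      _ = 12 * (cτ * Real.sqrt (4 * Real.pi * τ)) * (Real.exp (4 * y ^ (6 / 5 : ℝ) / τ) *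
          Real.exp (2 * Real.log y) * Real.exp (-(y ^ (4 / 3 : ℝ) / (16 * τ)))) := by ring
      _ = 1 / 2 * Real.exp (Real.log 48 + 2 * Real.log y + 4 * y ^ (6 / 5 : ℝ) / τ +
            -(y ^ (4 / 3 : ℝ) / (16 * τ))) := by
          rw [hcsqrt, Real.exp_add, Real.exp_add, Real.exp_add, Real.exp_log (by norm_num)]; ring
      _ ≤ 1 / 2 * Real.exp (-(y ^ (4 / 3 : ℝ) / (18 * τ))) := by
          gcongr 1 / 2 * ?_
          rw [Real.exp_le_exp]
          have e : -(y ^ (4 / 3 : ℝ) / (18 * τ)) =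
              y ^ (4 / 3 : ℝ) / (144 * τ) + -(y ^ (4 / 3 : ℝ) / (16 * τ)) := by
            field_simp; ring
          rw [e]; linarith
  -- the horizontal pieces
  have hErr2 : cτ * (2 * (2 * y ^ (3 / 5 : ℝ) * Real.exp (-(y ^ (4 / 3 : ℝ) / (5 * τ))))) ≤
      1 / 2 * Real.exp (-(y ^ (4 / 3 : ℝ) / (18 * τ))) := by
    have e35 : y ^ (3 / 5 : ℝ) = Real.exp (3 / 5 * Real.log y) := by
      rw [Real.rpow_def_of_pos hy0]; ring_nf
    have e1 : cτ * (2 * (2 * y ^ (3 / 5 : ℝ) * Real.exp (-(y ^ (4 / 3 : ℝ) / (5 * τ))))) =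
        1 / 2 * Real.exp (Real.log (8 * cτ) + 3 / 5 * Real.log y + -(y ^ (4 / 3 : ℝ) / (5 * τ))) := by
      rw [Real.exp_add, Real.exp_add, Real.exp_log (by positivity), ← e35]; ring
    rw [e1]
    gcongr 1 / 2 * ?_
    rw [Real.exp_le_exp]
    have hq : 0 ≤ y ^ (4 / 3 : ℝ) / τ := by positivity
    have e2 : y ^ (4 / 3 : ℝ) / (10 * τ) = y ^ (4 / 3 : ℝ) / τ / 10 := by
      rw [div_div, mul_comm]
    have e3 : -(y ^ (4 / 3 : ℝ) / (18 * τ)) = -(y ^ (4 / 3 : ℝ) / τ / 18) := by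
      rw [div_div, mul_comm]
    have e4 : -(y ^ (4 / 3 : ℝ) / (5 * τ)) = -(y ^ (4 / 3 : ℝ) / τ / 5) := by
      rw [div_div, mul_comm]
    rw [e2] at hcondHH
    rw [e3, e4]
    linarith
  calc _ ≤ 1 / 2 * Real.exp (-(y ^ (4 / 3 : ℝ) / (18 * τ))) +
        1 / 2 * Real.exp (-(y ^ (4 / 3 : ℝ) / (18 * τ))) := add_le_add hErr1 hErr2
    _ = _ := by ring

set_option maxHeartbeats 400000 in
/-- **Dobner's Lemma 4, the contour step**: for `t < 0` and real `C` there is `y₀` such that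
for `|Re s| ≤ C (Im s)^{1/4}`, `Im s ≥ y₀`, `n ≥ 1`, `log n ≤ (Im s)^{3/5}/|t|`, with
`c = s + log n/(2A)` and `Y = (Im s)^{2/3}`:
`‖B_{t,n}(s) − (π|t|)^{-1/2} ∫_{−Y}^{Y} 𝓘(c + iu) du‖ ≤ e^{−(Im s)^{4/3}/(18|t|)}`
(the pieces `V₁, H₁, H₂, V₂` of [Dobner2021, p. 12]). [cite: Dobner2021, proof of Lemma 4 (i),(ii)] -/
theorem dobner_lemma4_contour {t : ℝ} (ht : t < 0) (C : ℝ) :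
    ∃ y₀ : ℝ, ∀ s : ℂ, |s.re| ≤ C * s.im ^ (1 / 4 : ℝ) → y₀ ≤ s.im → ∀ n : ℕ, 1 ≤ n →
      Real.log n ≤ s.im ^ (3 / 5 : ℝ) / |t| →
        ‖dobnerB t n s - ((1 / Real.sqrt (Real.pi * |t|) : ℝ) : ℂ) *
            ∫ u in (-(s.im ^ (2 / 3 : ℝ)))..(s.im ^ (2 / 3 : ℝ)),
              dobnerI t n s (dobnerCenter t n s + u * I)‖ ≤
          Real.exp (-(s.im ^ (4 / 3 : ℝ) / (18 * |t|))) := by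
  have ht0 : t ≠ 0 := ht.ne
  have hτ : 0 < |t| := abs_pos.2 ht0
  set τ : ℝ := |t| with hτdef
  have hpi := Real.pi_gt_three
  have hpi4 := Real.pi_le_four
  set cτ : ℝ := 1 / Real.sqrt (Real.pi * τ) with hcτ
  have hcτ0 : 0 < cτ := by positivity
  -- largeness conditions on `y`
  have evA : ∀ᶠ y : ℝ in atTop, 2 * Real.pi ≤ y ∧ τ ≤ y ∧ 3 + τ ≤ y ∧ 8 ≤ y := by
    filter_upwards [eventually_ge_atTop (2 * Real.pi), eventually_ge_atTop τ,
      eventually_ge_atTop (3 + τ), eventually_ge_atTop (8 : ℝ)] with y h1 h2 h3 h4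
    exact ⟨h1, h2, h3, h4⟩
  have evB : ∀ᶠ y : ℝ in atTop, C * y ^ (1 / 4 : ℝ) + τ / 4 * Real.log y ≤ y ^ (3 / 5 : ℝ) ∧
      2 + C * y ^ (1 / 4 : ℝ) ≤ y ^ (3 / 5 : ℝ) ∧ 2 ≤ y ^ (3 / 5 : ℝ) := by
    filter_upwards [eventually_const_mul_rpow_le_rpow (2 * C) (by norm_num : (1 / 4 : ℝ) < 3 / 5),
      eventually_const_mul_log_le_rpow (2 * (τ / 4)) (by norm_num : (0 : ℝ) < 3 / 5),
      eventually_const_le_rpow (4 : ℝ) (by norm_num : (0 : ℝ) < 3 / 5)] with y h1 h2 h3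
    exact ⟨by linarith, by linarith, by linarith⟩
  have evC : ∀ᶠ y : ℝ in atTop, 2 * y ^ (3 / 5 : ℝ) ≤ y / 4 ∧ y ^ (2 / 3 : ℝ) ≤ y / 4 ∧
      y ^ (3 / 5 : ℝ) + τ ≤ y ^ (2 / 3 : ℝ) / 2 := by
    filter_upwards [eventually_const_mul_rpow_le_rpow 8 (by norm_num : (3 / 5 : ℝ) < 1),
      eventually_const_mul_rpow_le_rpow 4 (by norm_num : (2 / 3 : ℝ) < 1),
      eventually_const_mul_rpow_le_rpow 4 (by norm_num : (3 / 5 : ℝ) < 2 / 3),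
      eventually_const_le_rpow (4 * τ) (by norm_num : (0 : ℝ) < 2 / 3)] with y h1 h2 h3 h4
    rw [Real.rpow_one] at h1 h2
    exact ⟨by linarith, by linarith, by linarith⟩
  have evD : ∀ᶠ y : ℝ in atTop, Real.log 16 + 2 * Real.log y + 3 * y ^ (3 / 5 : ℝ) +
      2 * y ^ (3 / 5 : ℝ) * Real.log y + 11 * y ^ (6 / 5 : ℝ) / τ ≤ y ^ (4 / 3 : ℝ) / (20 * τ) := by
    filter_upwards [eventually_const_le_rpow (100 * τ * Real.log 16) (by norm_num : (0 : ℝ) < 4 / 3),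
      eventually_const_mul_log_le_rpow (100 * τ * 2) (by norm_num : (0 : ℝ) < 4 / 3),
      eventually_const_mul_rpow_le_rpow (100 * τ * 3) (by norm_num : (3 / 5 : ℝ) < 4 / 3),
      eventually_const_mul_rpow_mul_log_le_rpow (100 * τ * 2) (by norm_num : (3 / 5 : ℝ) < 4 / 3),
      eventually_const_mul_rpow_le_rpow (100 * 11) (by norm_num : (6 / 5 : ℝ) < 4 / 3)]
      with y h1 h2 h3 h4 h5
    have hτ20 : 0 < 20 * τ := by positivity
    rw [le_div_iff₀ hτ20]
    have e : (Real.log 16 + 2 * Real.log y + 3 * y ^ (3 / 5 : ℝ) + 2 * y ^ (3 / 5 : ℝ) * Real.log y +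
        11 * y ^ (6 / 5 : ℝ) / τ) * (20 * τ) =
        20 * τ * Real.log 16 + 20 * τ * 2 * Real.log y + 20 * τ * 3 * y ^ (3 / 5 : ℝ) +
          20 * τ * 2 * y ^ (3 / 5 : ℝ) * Real.log y + 220 * y ^ (6 / 5 : ℝ) := by
      field_simp; ring
    rw [e]; linarith
  have evE : ∀ᶠ y : ℝ in atTop,
      Real.log 48 + 2 * Real.log y + 4 * y ^ (6 / 5 : ℝ) / τ ≤ y ^ (4 / 3 : ℝ) / (144 * τ) ∧
        Real.log (8 * cτ) + 3 / 5 * Real.log y ≤ y ^ (4 / 3 : ℝ) / (10 * τ) := by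
    filter_upwards [eventually_const_le_rpow (432 * τ * Real.log 48) (by norm_num : (0 : ℝ) < 4 / 3),
      eventually_const_mul_log_le_rpow (432 * τ * 2) (by norm_num : (0 : ℝ) < 4 / 3),
      eventually_const_mul_rpow_le_rpow (432 * 4) (by norm_num : (6 / 5 : ℝ) < 4 / 3),
      eventually_const_le_rpow (20 * τ * Real.log (8 * cτ)) (by norm_num : (0 : ℝ) < 4 / 3),
      eventually_const_mul_log_le_rpow (20 * τ * (3 / 5)) (by norm_num : (0 : ℝ) < 4 / 3)]
      with y h1 h2 h3 h4 h5
    constructor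
    · rw [le_div_iff₀ (by positivity)]
      have e : (Real.log 48 + 2 * Real.log y + 4 * y ^ (6 / 5 : ℝ) / τ) * (144 * τ) =
          144 * τ * Real.log 48 + 144 * τ * 2 * Real.log y + 576 * y ^ (6 / 5 : ℝ) := by
        field_simp; ring
      rw [e]; linarith
    · rw [le_div_iff₀ (by positivity)]
      linarith
  obtain ⟨y₀, hy₀⟩ := eventually_atTop.1 ((evA.and evB).and ((evC.and evD).and evE))
  refine ⟨y₀, fun s hx hy n hn hℓ ↦ ?_⟩
  obtain ⟨⟨⟨hy2pi, hyτ, hy3τ, hy8⟩, ⟨hJb, hcre, h2y35⟩⟩, ⟨⟨hy35, hy23, hYc⟩, hcondH⟩, hcondO, hcondHH⟩ :=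
    hy₀ s.im hy
  -- notation
  set y : ℝ := s.im with hydef
  set x : ℝ := s.re with hxdef
  set ℓ : ℝ := Real.log n with hℓdef
  set J : ℂ := dobnerJ t s with hJdef
  set lam : ℂ := dobnerShift t n s with hlam
  set c : ℂ := dobnerCenter t n s with hcdef
  set Y : ℝ := y ^ (2 / 3 : ℝ) with hYdef
  have hy0 : 0 < y := by linarith
  have hy1 : 1 ≤ y := by linarith
  have hY0 : 0 < Y := Real.rpow_pos_of_pos hy0 _
  have h35 : 0 ≤ y ^ (3 / 5 : ℝ) := Real.rpow_nonneg hy0.le _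
  -- sizes of `λ`, `c`, `J`
  have hlam1 : ‖lam‖ ≤ y ^ (3 / 5 : ℝ) := by
    have h1 := norm_dobnerShift_le ht0 (s := s) hy0 (by linarith) n
    rw [← hlam, ← hℓdef] at h1
    calc ‖lam‖ ≤ τ * ℓ := h1
      _ ≤ τ * (y ^ (3 / 5 : ℝ) / τ) := mul_le_mul_of_nonneg_left hℓ hτ.le
      _ = y ^ (3 / 5 : ℝ) := by field_simp
  have hlam_re : |lam.re| ≤ y ^ (3 / 5 : ℝ) := (Complex.abs_re_le_norm _).trans hlam1
  have hlam_im : |lam.im| ≤ y ^ (3 / 5 : ℝ) := (Complex.abs_im_le_norm _).trans hlam1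
  have hc_re : c.re = x + lam.re := by rw [hcdef, dobnerCenter, Complex.add_re]
  have hc_im : c.im = y + lam.im := by rw [hcdef, dobnerCenter, Complex.add_im]
  have hxb : |x| ≤ C * y ^ (1 / 4 : ℝ) := hx
  have hcre_abs : |c.re| + 2 ≤ 2 * y ^ (3 / 5 : ℝ) := by
    rw [hc_re]
    have := abs_add_le x lam.re
    linarith
  have hxy : |x| ≤ y := by linarith
  have hJre0 : |J.re| ≤ y ^ (3 / 5 : ℝ) := by
    have h1 := abs_dobnerJ_re_sub_re_le t (s := s) hy2pi hxy
    rw [← hJdef, ← hxdef, ← hydef] at h1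
    calc |J.re| = |(J.re - x) + x| := by ring_nf
      _ ≤ |J.re - x| + |x| := abs_add_le _ _
      _ ≤ τ / 4 * Real.log y + C * y ^ (1 / 4 : ℝ) := add_le_add h1 hxb
      _ ≤ y ^ (3 / 5 : ℝ) := by linarith
  have hJim := dobnerJ_im_mem t (s := s) hy0
  rw [← hJdef, ← hydef] at hJim
  have hJim0 : 0 < J.im := by linarith [hJim.1]
  have hJimτ : J.im ≤ y + τ := by
    have h := mul_le_mul_of_nonneg_right hpi4 hτ.le
    rw [← hτdef] at hJim; linarith [hJim.2]
  -- the heights `h₁ = Im c − Y`, `h₂ = Im c + Y`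
  have hh1 : y / 2 ≤ c.im - Y := by
    rw [hc_im]; linarith [(abs_le.1 hlam_im).1]
  have hh1pos : 0 < c.im - Y := by linarith
  have hh2 : c.im + Y ≤ 2 * y := by rw [hc_im]; linarith [(abs_le.1 hlam_im).2]
  have hJh1 : Y / 2 ≤ |J.im - (c.im - Y)| := by
    rw [hc_im]
    have : Y / 2 ≤ J.im - (y + lam.im - Y) := by linarith [hJim.1, (abs_le.1 hlam_im).2]
    exact this.trans (le_abs_self _)
  have hJh2 : Y / 2 ≤ |J.im - (c.im + Y)| := by
    rw [hc_im]
    have : Y / 2 ≤ (y + lam.im + Y) - J.im := by linarith [(abs_le.1 hlam_im).1]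
    rw [abs_sub_comm]; exact this.trans (le_abs_self _)
  -- Step 1: the contour identity
  have hident := integral_dobnerI_two_eq t hn s c hY0 hh1pos
  -- Step 2: the horizontal pieces
  have hylog : Real.log (2 * y ^ (3 / 5 : ℝ)) ≤ Real.log y :=
    Real.log_le_log (by positivity) (by linarith)
  have hH : ∀ h : ℝ, (h = c.im - Y ∨ h = c.im + Y) →
      ‖∫ r in (2 : ℝ)..c.re, dobnerI t n s (r + (h : ℂ) * I)‖ ≤
        2 * y ^ (3 / 5 : ℝ) * Real.exp (-(y ^ (4 / 3 : ℝ) / (5 * τ))) := by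
    intro h hh
    have hhge : y / 2 ≤ h := by rcases hh with rfl | rfl <;> linarith
    have hhle : h ≤ 2 * y := by rcases hh with rfl | rfl <;> linarith
    have hJh : Y / 2 ≤ |J.im - h| := by rcases hh with rfl | rfl <;> assumption
    have hbound : ∀ r ∈ Set.uIoc (2 : ℝ) c.re, ‖dobnerI t n s (r + (h : ℂ) * I)‖ ≤
        Real.exp (-(y ^ (4 / 3 : ℝ) / (5 * τ))) := by
      intro r hr
      have hr' : r ∈ Set.uIcc (2 : ℝ) c.re := Set.uIoc_subset_uIcc hr
      have hrabs : |r| ≤ 2 * y ^ (3 / 5 : ℝ) := by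
        rcases Set.mem_uIcc.1 hr' with ⟨h1, h2⟩ | ⟨h1, h2⟩
        · rw [abs_le]; constructor <;> linarith [le_abs_self c.re, neg_abs_le c.re]
        · rw [abs_le]; constructor <;> linarith [le_abs_self c.re, neg_abs_le c.re]
      exact norm_dobnerI_horizontal_le ht0 hn s hy1 hrabs (by linarith) (by linarith) (by linarith)
        hℓ hJre0 hJh hylog hcondH
    refine (intervalIntegral.norm_integral_le_of_norm_le_const hbound).trans ?_
    rw [mul_comm]
    refine mul_le_mul_of_nonneg_right ?_ (Real.exp_pos _).le
    calc |c.re - 2| ≤ |c.re| + |(2 : ℝ)| := abs_sub _ _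
      _ = |c.re| + 2 := by rw [abs_two]
      _ ≤ 2 * y ^ (3 / 5 : ℝ) := hcre_abs
  -- Step 3: the outer part of the line `Re z = 2`
  set P : ℝ := 3 + J.im with hPdef
  set Kout : ℝ := Real.exp ((J.re - 2) ^ 2 / τ) * (2 * P ^ 2 + 4 * τ) * Real.exp (-(Y ^ 2 / (16 * τ)))
    with hKout
  have hKout0 : 0 ≤ Kout := by positivity
  have hOuter : ‖(∫ v : ℝ, dobnerI t n s (2 + v * I)) -
      ∫ v in (c.im - Y)..(c.im + Y), dobnerI t n s (2 + v * I)‖ ≤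
        Kout * Real.sqrt (2 * Real.pi * (2 * τ)) := by
    have hint2 : Integrable fun v : ℝ ↦ dobnerI t n s (2 + v * I) := by
      simpa using integrable_dobnerI_vertical ht0 hn s (σ := 2) (by norm_num)
    have hg := (integrable_exp_neg_sq_sub_div J.im (show 0 < 2 * τ by positivity)).const_mul Kout
    have h1 := norm_integral_sub_intervalIntegral_le (by linarith : c.im - Y ≤ c.im + Y) hint2 hg
      (fun v hv ↦ ?_) (fun v ↦ by positivity)
    · rwa [MeasureTheory.integral_const_mul, integral_exp_neg_sq_sub_div J.im (by positivity)] at h1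
    · -- off `(Im c − Y, Im c + Y)`: `|v − Im J| ≥ Y/2`
      have hvJ : Y / 2 ≤ |v - J.im| := by
        rw [Set.mem_Ioo, not_and_or, not_lt, not_lt] at hv
        rcases hv with hv | hv
        · have : Y / 2 ≤ J.im - v := by
            have := (abs_le.1 hlam_im).2
            rw [hc_im] at hv; linarith [hJim.1]
          rw [abs_sub_comm]; exact this.trans (le_abs_self _)
        · have : Y / 2 ≤ v - J.im := by
            have := (abs_le.1 hlam_im).1
            rw [hc_im] at hv; linarith
          exact this.trans (le_abs_self _)
      have h2 := norm_dobnerI_two_le ht0 hn s (Y := Y) hY0.le v hJim0 hvJ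
      rw [← hJdef] at h2
      calc ‖dobnerI t n s (2 + v * I)‖ ≤ _ := h2
        _ = Kout * Real.exp (-((v - J.im) ^ 2 / (2 * (2 * τ)))) := by rw [hKout, hPdef]
  -- Step 4: numerics
  have hcsqrt : cτ * Real.sqrt (4 * Real.pi * τ) = 2 := by
    rw [hcτ, show 4 * Real.pi * τ = 2 ^ 2 * (Real.pi * τ) by ring,
      Real.sqrt_mul (by norm_num) (Real.pi * τ), Real.sqrt_sq (by norm_num)]
    field_simp
  have hnum := dobner_contour_numerics (Jre := J.re) (P := P) hτ hy1 hcτ0 hcsqrt hJre0 h2y35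
    (by rw [hPdef]; linarith) (by rw [hPdef]; linarith) hyτ hYdef hcondO hcondHH
  -- Step 5: assemble
  rw [dobnerB_eq_integral_dobnerI, ← mul_sub, norm_mul, Complex.norm_real, Real.norm_eq_abs,
    abs_of_pos hcτ0]
  have hsplit : (∫ v : ℝ, dobnerI t n s (2 + v * I)) - ∫ u in (-Y)..Y, dobnerI t n s (c + u * I) =
      ((∫ v : ℝ, dobnerI t n s (2 + v * I)) -
          ∫ v in (c.im - Y)..(c.im + Y), dobnerI t n s (2 + v * I)) -
        I * ((∫ r in (2 : ℝ)..c.re, dobnerI t n s (r + ((c.im - Y : ℝ) : ℂ) * I)) -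
          ∫ r in (2 : ℝ)..c.re, dobnerI t n s (r + ((c.im + Y : ℝ) : ℂ) * I)) := by
    set Vfull := ∫ v : ℝ, dobnerI t n s (2 + v * I) with hVfull
    set V := ∫ v in (c.im - Y)..(c.im + Y), dobnerI t n s (2 + v * I)
    set M := ∫ u in (-Y)..Y, dobnerI t n s (c + u * I)
    set H1 := ∫ r in (2 : ℝ)..c.re, dobnerI t n s (r + ((c.im - Y : ℝ) : ℂ) * I)
    set H2 := ∫ r in (2 : ℝ)..c.re, dobnerI t n s (r + ((c.im + Y : ℝ) : ℂ) * I)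
    linear_combination hident
  rw [hsplit]
  have hH1 := hH (c.im - Y) (Or.inl rfl)
  have hH2 := hH (c.im + Y) (Or.inr rfl)
  calc cτ * ‖((∫ v : ℝ, dobnerI t n s (2 + v * I)) -
          ∫ v in (c.im - Y)..(c.im + Y), dobnerI t n s (2 + v * I)) -
        I * ((∫ r in (2 : ℝ)..c.re, dobnerI t n s (r + ((c.im - Y : ℝ) : ℂ) * I)) -
          ∫ r in (2 : ℝ)..c.re, dobnerI t n s (r + ((c.im + Y : ℝ) : ℂ) * I))‖
      ≤ cτ * (Kout * Real.sqrt (2 * Real.pi * (2 * τ)) +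
          2 * (2 * y ^ (3 / 5 : ℝ) * Real.exp (-(y ^ (4 / 3 : ℝ) / (5 * τ))))) := by
        refine mul_le_mul_of_nonneg_left ?_ hcτ0.le
        refine (norm_sub_le _ _).trans (add_le_add hOuter ?_)
        rw [norm_mul, Complex.norm_I, one_mul]
        refine (norm_sub_le _ _).trans ?_
        push_cast at hH1 hH2 ⊢
        linarith
    _ = cτ * (Kout * Real.sqrt (2 * Real.pi * (2 * τ))) +
        cτ * (2 * (2 * y ^ (3 / 5 : ℝ) * Real.exp (-(y ^ (4 / 3 : ℝ) / (5 * τ))))) := by ring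
    _ ≤ Real.exp (-(y ^ (4 / 3 : ℝ) / (18 * τ))) := by rw [hKout]; exact hnum


/-! ## Parts (i)/(ii), step 2: the saddle-point segment `M` (Lemma 5 applied, Gaussian main term) -/

/-! ## Elementary inequalities -/

/-- `‖e^x − 1‖ ≤ 2‖x‖ e^{‖x‖}` for all complex `x`. [folklore] -/
theorem norm_cexp_sub_one_le (x : ℂ) : ‖Complex.exp x - 1‖ ≤ 2 * ‖x‖ * Real.exp ‖x‖ := by
  have h0 : 0 ≤ ‖x‖ := norm_nonneg x
  have h1 : 1 ≤ Real.exp ‖x‖ := Real.one_le_exp h0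
  rcases le_or_gt ‖x‖ 1 with h | h
  · calc ‖Complex.exp x - 1‖ ≤ 2 * ‖x‖ := Complex.norm_exp_sub_one_le h
      _ = 2 * ‖x‖ * 1 := by ring
      _ ≤ 2 * ‖x‖ * Real.exp ‖x‖ := by gcongr
  · calc ‖Complex.exp x - 1‖ ≤ ‖Complex.exp x‖ + ‖(1 : ℂ)‖ := norm_sub_le _ _
      _ ≤ Real.exp ‖x‖ + 1 := by rw [norm_one]; exact add_le_add (Complex.norm_exp_le_exp_norm x) le_rfl
      _ ≤ 2 * 1 * Real.exp ‖x‖ := by linarith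
      _ ≤ 2 * ‖x‖ * Real.exp ‖x‖ := by gcongr

/-- `1 + |u|³ ≤ (2 + 2/c²) e^{c u²}` for `c > 0`. [folklore] -/
theorem one_add_abs_pow_three_le {c : ℝ} (hc : 0 < c) (u : ℝ) :
    1 + |u| ^ 3 ≤ (2 + 2 / c ^ 2) * Real.exp (c * u ^ 2) := by
  have h1 : (c * u ^ 2) ^ 2 / 2 ≤ Real.exp (c * u ^ 2) := by
    have := Real.quadratic_le_exp_of_nonneg (show 0 ≤ c * u ^ 2 by positivity)
    nlinarith [sq_nonneg u]
  have h2 : u ^ 4 ≤ 2 / c ^ 2 * Real.exp (c * u ^ 2) := by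
    rw [div_mul_eq_mul_div, le_div_iff₀ (by positivity)]
    nlinarith
  have h3 : |u| ^ 3 ≤ 1 + u ^ 4 := by
    have hu := abs_nonneg u
    have e4 : u ^ 4 = |u| ^ 4 := (Even.pow_abs (by norm_num : Even 4) u).symm
    rw [e4]
    rcases le_or_gt |u| 1 with h | h
    · have : |u| ^ 3 ≤ 1 := pow_le_one₀ hu h
      nlinarith [pow_nonneg hu 4]
    · nlinarith [pow_pos (lt_trans zero_lt_one h) 3]
  have h4 : 1 ≤ Real.exp (c * u ^ 2) := Real.one_le_exp (by positivity)
  nlinarith [div_nonneg (show (0:ℝ) ≤ 2 by norm_num) (sq_nonneg c)]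

/-! ## The factorisation of the integrand near `s` (Lemma 5 applied) -/

/-- `Log(s/2) = Log(s/(2π)) + log π` (`π > 0` does not change the argument). [folklore] -/
theorem log_half_eq {s : ℂ} (hs : s ≠ 0) :
    Complex.log (s / 2) = Complex.log (s / (2 * Real.pi)) + Real.log Real.pi := by
  have hpi := Real.pi_pos
  have e : s / (2 * Real.pi) = ((Real.pi⁻¹ : ℝ) : ℂ) * (s / 2) := by
    push_cast; field_simp
  rw [e, Complex.log_ofReal_mul (inv_pos.2 hpi) (div_ne_zero hs two_ne_zero), Real.log_inv]
  push_cast; ring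

/-- **Factorisation of `𝓘` near `s`** ([Dobner2021, Lemma 5] for `F = ζ`, via
`Literature.Analysis.SpecialFunctions.Complex.Gamma_eq_mul_exp_taylor`, combined with the design of `J_t`): if `Im s > 0`,
`Im(s+ζ) > 0`, `‖ζ‖ ≤ ‖s‖/2` and `‖ψ − Log‖ ≤ ε` on the segment `[s/2, (s+ζ)/2]`, then
`𝓘(s+ζ) = γ_t(s) n^{−s} e^{Aζ² − ζ log n} · ((s+ζ)(s+ζ−1)/(s(s−1))) e^{E}` with
`‖E‖ ≤ ε‖ζ/2‖ + 2‖ζ/2‖³/‖s/2‖²`. [cite: Dobner2021, Lemma 5 and eq. (4.2)–(4.4)] -/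
theorem dobnerI_center_eq {t : ℝ} (ht : t ≠ 0) {n : ℕ} (hn : 1 ≤ n) {s ζ : ℂ} (hs : 0 < s.im)
    (hsζ : 0 < (s + ζ).im) (hd : ‖ζ / 2‖ ≤ ‖s / 2‖ / 2) {ε : ℝ}
    (hψ : ∀ τ' ∈ Set.Icc (0 : ℝ) 1, ‖Complex.digamma (s / 2 + τ' * (ζ / 2)) -
      Complex.log (s / 2 + τ' * (ζ / 2))‖ ≤ ε) :
    ∃ E : ℂ, ‖E‖ ≤ ε * ‖ζ / 2‖ + 2 * ‖ζ / 2‖ ^ 3 / ‖s / 2‖ ^ 2 ∧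
      dobnerI t n s (s + ζ) = dobnerGammaT t s * (n : ℂ) ^ (-s) *
        Complex.exp (dobnerA t s * ζ ^ 2 - (Real.log n : ℂ) * ζ) *
        ((s + ζ) * (s + ζ - 1) / (s * (s - 1)) * Complex.exp E) := by
  have ht' : 0 < |t| := abs_pos.2 ht
  have hs0 : s ≠ 0 := fun h ↦ by simp [h] at hs
  have hs1 : s - 1 ≠ 0 := fun h ↦ by
    have := congrArg Complex.im h; simp at this; linarith
  have hn0 : (n : ℂ) ≠ 0 := by exact_mod_cast (show n ≠ 0 by omega)
  have hpi0 : (Real.pi : ℂ) ≠ 0 := by exact_mod_cast Real.pi_ne_zero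
  have h₀ : 0 < (s / 2).im := by simp; linarith
  have h₁ : 0 < (s / 2 + ζ / 2).im := by
    simp only [Complex.add_im, Complex.div_ofNat_im] at hsζ ⊢; linarith
  obtain ⟨E, hE, hΓ⟩ := Literature.Analysis.SpecialFunctions.Complex.Gamma_eq_mul_exp_taylor h₀ h₁ hd hψ
  refine ⟨E, hE, ?_⟩
  -- expand both sides
  have hτA : dobnerA t s = ((1 / |t| : ℝ) : ℂ) + 1 / (4 * s) := rfl
  set L : ℂ := Complex.log (s / (2 * Real.pi)) with hL
  have hJ : dobnerJ t s = s + ((|t| / 4 : ℝ) : ℂ) * L := rfl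
  have hlog2 : Complex.log (s / 2) = L + Real.log Real.pi := log_half_eq hs0
  -- the Gamma factors
  have hG1 : Gammaℝ (s + ζ) = (Real.pi : ℂ) ^ (-(s + ζ) / 2) * Complex.Gamma (s / 2 + ζ / 2) := by
    rw [Gammaℝ_def]; congr 2; ring
  rw [dobnerI, dobnerGammaT, xiGammaFactor, xiGammaFactor, hG1, hΓ, Gammaℝ_def,
    Complex.cpow_def_of_ne_zero hpi0, Complex.cpow_def_of_ne_zero hpi0,
    Complex.cpow_def_of_ne_zero hn0, Complex.cpow_def_of_ne_zero hn0, hJ, hτA, hlog2]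
  rw [← Complex.natCast_log]
  -- collect the exponentials
  set G := Complex.Gamma (s / 2) with hG
  set lπ : ℂ := Complex.log (Real.pi : ℂ) with hlπ
  set ln : ℂ := ((Real.log n : ℝ) : ℂ) with hln
  have hlπ' : (Real.log Real.pi : ℂ) = lπ := by rw [hlπ, Complex.ofReal_log Real.pi_pos.le]
  rw [hlπ']
  -- exponent identity
  have hexp : lπ * (-(s + ζ) / 2) + ((L + lπ) * (ζ / 2) + (ζ / 2) ^ 2 / (2 * (s / 2)) + E) +
      ln * -(s + ζ) + ((1 / |t| : ℝ) : ℂ) * (s + ((|t| / 4 : ℝ) : ℂ) * L - (s + ζ)) ^ 2 =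
      lπ * (-s / 2) + ((1 / |t| : ℝ) : ℂ) * (s - (s + ((|t| / 4 : ℝ) : ℂ) * L)) ^ 2 + ln * -s +
        ((((1 / |t| : ℝ) : ℂ) + 1 / (4 * s)) * ζ ^ 2 - ln * ζ) + E := by
    have hτ0 : ((|t| : ℝ) : ℂ) ≠ 0 := by exact_mod_cast ht'.ne'
    push_cast
    field_simp
    ring
  -- now both sides are `(s+ζ)(s+ζ-1)/2 · G · exp(sum)`
  have c4 : ∀ a b c d : ℂ, Complex.exp a * Complex.exp b * Complex.exp c * Complex.exp d =
      Complex.exp (a + b + c + d) := fun a b c d ↦ by simp only [Complex.exp_add]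
  have c5 : ∀ a b c d e : ℂ, Complex.exp a * Complex.exp b * Complex.exp c * Complex.exp d *
      Complex.exp e = Complex.exp (a + b + c + d + e) := fun a b c d e ↦ by
    simp only [Complex.exp_add]
  calc _ = (s + ζ) * (s + ζ - 1) / 2 * G * (Complex.exp (lπ * (-(s + ζ) / 2)) *
        Complex.exp ((L + lπ) * (ζ / 2) + (ζ / 2) ^ 2 / (2 * (s / 2)) + E) *
        Complex.exp (ln * -(s + ζ)) *
        Complex.exp (((1 / |t| : ℝ) : ℂ) * (s + ((|t| / 4 : ℝ) : ℂ) * L - (s + ζ)) ^ 2)) := by ring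
    _ = (s + ζ) * (s + ζ - 1) / 2 * G * Complex.exp (lπ * (-(s + ζ) / 2) +
        ((L + lπ) * (ζ / 2) + (ζ / 2) ^ 2 / (2 * (s / 2)) + E) + ln * -(s + ζ) +
        ((1 / |t| : ℝ) : ℂ) * (s + ((|t| / 4 : ℝ) : ℂ) * L - (s + ζ)) ^ 2) := by rw [c4]
    _ = (s + ζ) * (s + ζ - 1) / 2 * G * Complex.exp (lπ * (-s / 2) +
        ((1 / |t| : ℝ) : ℂ) * (s - (s + ((|t| / 4 : ℝ) : ℂ) * L)) ^ 2 + ln * -s +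
        ((((1 / |t| : ℝ) : ℂ) + 1 / (4 * s)) * ζ ^ 2 - ln * ζ) + E) := by rw [hexp]
    _ = (s + ζ) * (s + ζ - 1) / 2 * G * (Complex.exp (lπ * (-s / 2)) *
        Complex.exp (((1 / |t| : ℝ) : ℂ) * (s - (s + ((|t| / 4 : ℝ) : ℂ) * L)) ^ 2) *
        Complex.exp (ln * -s) *
        Complex.exp ((((1 / |t| : ℝ) : ℂ) + 1 / (4 * s)) * ζ ^ 2 - ln * ζ) * Complex.exp E) := by
          rw [c5]
    _ = _ := by field_simp

/-- **On the segment `ζ = λ + iu`**: `Aζ² − ζ log n = −log² n/(4A) − A u²` (completing the square,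
`λ = log n/(2A)`). [cite: Dobner2021, proof of Lemma 4 (completing the square)] -/
theorem dobnerA_sq_sub_on_segment {t : ℝ} {s : ℂ} (hA : dobnerA t s ≠ 0) (n : ℕ) (u : ℝ) :
    dobnerA t s * (dobnerShift t n s + u * I) ^ 2 - (Real.log n : ℂ) * (dobnerShift t n s + u * I) =
      -((Real.log n : ℂ) ^ 2 / (4 * dobnerA t s)) + -(dobnerA t s * (u : ℂ) ^ 2) := by
  rw [dobnerShift]
  field_simp
  ring_nf
  rw [Complex.I_sq]
  ring

/-! ## The relative error `Q − 1` -/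

/-- `‖(s+ζ)(s+ζ−1)/(s(s−1)) − 1‖ ≤ 4‖ζ‖/‖s‖` for `‖s‖ ≥ 2`, `‖ζ‖ ≤ ‖s‖/2`. [folklore] -/
theorem norm_poly_ratio_sub_one_le {s ζ : ℂ} (hs : 2 ≤ ‖s‖) (hζ : ‖ζ‖ ≤ ‖s‖ / 2) (hs0 : s ≠ 0)
    (hs1 : s - 1 ≠ 0) :
    ‖(s + ζ) * (s + ζ - 1) / (s * (s - 1)) - 1‖ ≤ 4 * ‖ζ‖ / ‖s‖ := by
  have hns : 0 < ‖s‖ := by linarith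
  have hns1 : ‖s‖ / 2 ≤ ‖s - 1‖ := by
    have := norm_sub_norm_le s 1; rw [norm_one] at this
    have h2 : ‖s‖ - 1 ≤ ‖s - 1‖ := by simpa using norm_sub_norm_le s 1
    linarith
  have e : (s + ζ) * (s + ζ - 1) / (s * (s - 1)) - 1 = ζ / s + ζ / (s - 1) + ζ ^ 2 / (s * (s - 1)) := by
    field_simp; ring
  rw [e]
  have h1 : ‖ζ / s‖ = ‖ζ‖ / ‖s‖ := norm_div _ _
  have h2 : ‖ζ / (s - 1)‖ ≤ 2 * ‖ζ‖ / ‖s‖ := by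
    rw [norm_div, div_le_div_iff₀ (by linarith) hns]
    nlinarith [norm_nonneg ζ]
  have h3 : ‖ζ ^ 2 / (s * (s - 1))‖ ≤ ‖ζ‖ / ‖s‖ := by
    have hs1' : 0 < ‖s - 1‖ := by linarith
    rw [norm_div, norm_pow, norm_mul, div_le_div_iff₀ (by positivity) hns]
    have hζ1 : ‖ζ‖ ≤ ‖s - 1‖ := hζ.trans hns1
    calc ‖ζ‖ ^ 2 * ‖s‖ = ‖ζ‖ * ‖ζ‖ * ‖s‖ := by ring
      _ ≤ ‖ζ‖ * ‖s - 1‖ * ‖s‖ := by gcongr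
      _ = ‖ζ‖ * (‖s‖ * ‖s - 1‖) := by ring
  calc ‖ζ / s + ζ / (s - 1) + ζ ^ 2 / (s * (s - 1))‖
      ≤ ‖ζ / s‖ + ‖ζ / (s - 1)‖ + ‖ζ ^ 2 / (s * (s - 1))‖ := norm_add₃_le
    _ ≤ ‖ζ‖ / ‖s‖ + 2 * ‖ζ‖ / ‖s‖ + ‖ζ‖ / ‖s‖ := by rw [h1]; gcongr
    _ = 4 * ‖ζ‖ / ‖s‖ := by ring

/-- **`‖Q − 1‖ ≤ e^{‖E‖} (4‖ζ‖/‖s‖ + 2‖E‖)`** for `Q = (s+ζ)(s+ζ−1)/(s(s−1)) · e^E`. [folklore] -/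
theorem norm_Q_sub_one_le {s ζ E : ℂ} (hs : 2 ≤ ‖s‖) (hζ : ‖ζ‖ ≤ ‖s‖ / 2) (hs0 : s ≠ 0)
    (hs1 : s - 1 ≠ 0) :
    ‖(s + ζ) * (s + ζ - 1) / (s * (s - 1)) * Complex.exp E - 1‖ ≤
      Real.exp ‖E‖ * (4 * ‖ζ‖ / ‖s‖ + 2 * ‖E‖) := by
  set P := (s + ζ) * (s + ζ - 1) / (s * (s - 1)) with hP
  have h1 := norm_poly_ratio_sub_one_le hs hζ hs0 hs1
  rw [← hP] at h1
  have h2 := norm_cexp_sub_one_le E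
  have h3 : ‖Complex.exp E‖ ≤ Real.exp ‖E‖ := Complex.norm_exp_le_exp_norm E
  have e : P * Complex.exp E - 1 = (P - 1) * Complex.exp E + (Complex.exp E - 1) := by ring
  rw [e]
  calc ‖(P - 1) * Complex.exp E + (Complex.exp E - 1)‖
      ≤ ‖P - 1‖ * ‖Complex.exp E‖ + ‖Complex.exp E - 1‖ := by
        rw [← norm_mul]; exact norm_add_le _ _
    _ ≤ 4 * ‖ζ‖ / ‖s‖ * Real.exp ‖E‖ + 2 * ‖E‖ * Real.exp ‖E‖ := by
        gcongr
    _ = Real.exp ‖E‖ * (4 * ‖ζ‖ / ‖s‖ + 2 * ‖E‖) := by ring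

/-! ## The Gaussian integral over `M` -/

/-- Tail of the complex Gaussian: for `a = Re A > 0`, `Y ≥ 0`,
`‖∫ e^{−Au²} du − ∫_{−Y}^{Y} e^{−Au²} du‖ ≤ e^{−aY²/2} √(2π/a)`. [folklore] -/
theorem norm_gaussian_tail_le {A : ℂ} (hA : 0 < A.re) {Y : ℝ} (hY : 0 ≤ Y) :
    ‖(∫ u : ℝ, Complex.exp (-A * (u : ℂ) ^ 2)) - ∫ u in (-Y)..Y, Complex.exp (-A * (u : ℂ) ^ 2)‖ ≤
      Real.exp (-(A.re * Y ^ 2 / 2)) * Real.sqrt (2 * Real.pi / A.re) := by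
  set a := A.re with ha
  have hg : Integrable fun u : ℝ ↦ Real.exp (-(a * Y ^ 2 / 2)) * Real.exp (-(a / 2) * u ^ 2) :=
    (integrable_exp_neg_mul_sq (by positivity)).const_mul _
  have h := norm_integral_sub_intervalIntegral_le (by linarith : -Y ≤ Y) (integrable_cexp_neg_mul_sq hA)
    hg (fun v hv ↦ ?_) (fun v ↦ by positivity)
  · refine h.trans (le_of_eq ?_)
    rw [MeasureTheory.integral_const_mul, integral_gaussian]
    congr 1; congr 1; field_simp
  · rw [norm_cexp_neg_mul_sq, ← ha]
    rw [Set.mem_Ioo, not_and_or, not_lt, not_lt] at hv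
    have hv2 : Y ^ 2 ≤ v ^ 2 := by
      rcases hv with hv | hv
      · nlinarith
      · nlinarith
    rw [← Real.exp_add, Real.exp_le_exp]
    nlinarith

/-- **The saddle-point piece** (cf. [Dobner2021, (4.5) and the two displays after it]): if on
`[−Y, Y]` the integrand differs from `main_A e^{−Au²}` by at most
`‖main_A‖ K₁ (1+|u|³) y^{−1/5} e^{−(Re A)u²}`, `Re A ≥ 1/(2|t|)`, then
`‖∫_{−Y}^{Y} 𝓘(c+iu) du − main_A (π/A)^{1/2}‖ ≤
  ‖main_A‖ (K₁ y^{−1/5} (2 + 32|t|²)√(4π|t|) + e^{−(Re A) Y²/2} √(2π/Re A))`.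
[cite: Dobner2021, proof of Lemma 4 (i),(ii): the `M` integral] -/
theorem dobner_M_estimate {t : ℝ} (ht : t ≠ 0) {F : ℝ → ℂ} {A mainA : ℂ} {Y K₁ y : ℝ}
    (hY : 0 ≤ Y) (hK : 0 ≤ K₁) (hy : 0 < y) (hA : 1 / (2 * |t|) ≤ A.re)
    (hFi : IntervalIntegrable F volume (-Y) Y)
    (hF : ∀ u ∈ Set.Icc (-Y) Y, ‖F u - mainA * Complex.exp (-A * (u : ℂ) ^ 2)‖ ≤
      ‖mainA‖ * (K₁ * (1 + |u| ^ 3) * y ^ (-(1 / 5 : ℝ))) * Real.exp (-(A.re * u ^ 2))) :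
    ‖(∫ u in (-Y)..Y, F u) - mainA * ((Real.pi : ℂ) / A) ^ (1 / 2 : ℂ)‖ ≤
      ‖mainA‖ * (K₁ * y ^ (-(1 / 5 : ℝ)) * ((2 + 32 * |t| ^ 2) * Real.sqrt (4 * Real.pi * |t|)) +
        Real.exp (-(A.re * Y ^ 2 / 2)) * Real.sqrt (2 * Real.pi / A.re)) := by
  have ht' : 0 < |t| := abs_pos.2 ht
  have hApos : 0 < A.re := lt_of_lt_of_le (by positivity) hA
  set a := A.re with ha
  set g : ℝ → ℂ := fun u ↦ Complex.exp (-A * (u : ℂ) ^ 2) with hgdef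
  have hgi : Integrable g := integrable_cexp_neg_mul_sq hApos
  have hgY : IntervalIntegrable g volume (-Y) Y := hgi.intervalIntegrable
  -- split
  have hGauss : ∫ u : ℝ, g u = ((Real.pi : ℂ) / A) ^ (1 / 2 : ℂ) := integral_gaussian_complex hApos
  have e : (∫ u in (-Y)..Y, F u) - mainA * ((Real.pi : ℂ) / A) ^ (1 / 2 : ℂ) =
      (∫ u in (-Y)..Y, (F u - mainA * g u)) -
        mainA * ((∫ u : ℝ, g u) - ∫ u in (-Y)..Y, g u) := by
    rw [intervalIntegral.integral_sub hFi (hgY.const_mul mainA), intervalIntegral.integral_const_mul,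
      hGauss]
    ring
  rw [e]
  -- the error integral
  set c : ℝ := 1 / (4 * |t|) with hc
  have hc0 : 0 < c := by positivity
  set Mτ : ℝ := (2 + 32 * |t| ^ 2) * Real.sqrt (4 * Real.pi * |t|) with hMτ
  have hbound_pt : ∀ u : ℝ, (1 + |u| ^ 3) * Real.exp (-(a * u ^ 2)) ≤
      (2 + 32 * |t| ^ 2) * Real.exp (-c * u ^ 2) := by
    intro u
    have h1 := one_add_abs_pow_three_le hc0 u
    have h2 : 2 + 2 / c ^ 2 = 2 + 32 * |t| ^ 2 := by rw [hc]; field_simp; ring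
    rw [h2] at h1
    have h3 : Real.exp (c * u ^ 2) * Real.exp (-(a * u ^ 2)) ≤ Real.exp (-c * u ^ 2) := by
      rw [← Real.exp_add, Real.exp_le_exp]
      have : 2 * c ≤ a := by rw [hc, ha]; convert hA using 1; field_simp; ring
      nlinarith [sq_nonneg u]
    calc (1 + |u| ^ 3) * Real.exp (-(a * u ^ 2))
        ≤ (2 + 32 * |t| ^ 2) * Real.exp (c * u ^ 2) * Real.exp (-(a * u ^ 2)) :=
          mul_le_mul_of_nonneg_right h1 (Real.exp_pos _).le
      _ = (2 + 32 * |t| ^ 2) * (Real.exp (c * u ^ 2) * Real.exp (-(a * u ^ 2))) := by ring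
      _ ≤ (2 + 32 * |t| ^ 2) * Real.exp (-c * u ^ 2) :=
          mul_le_mul_of_nonneg_left h3 (by positivity)
  have hh_int : Integrable fun u : ℝ ↦ (2 + 32 * |t| ^ 2) * Real.exp (-c * u ^ 2) :=
    (integrable_exp_neg_mul_sq hc0).const_mul _
  have hh_val : ∫ u : ℝ, (2 + 32 * |t| ^ 2) * Real.exp (-c * u ^ 2) = Mτ := by
    rw [MeasureTheory.integral_const_mul, integral_gaussian, hMτ]
    congr 2; rw [hc]; field_simp
  have herr : ‖∫ u in (-Y)..Y, (F u - mainA * g u)‖ ≤ ‖mainA‖ * (K₁ * y ^ (-(1 / 5 : ℝ))) * Mτ := by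
    have h1 : ‖∫ u in (-Y)..Y, (F u - mainA * g u)‖ ≤
        ∫ u in (-Y)..Y, ‖mainA‖ * (K₁ * y ^ (-(1 / 5 : ℝ))) * ((2 + 32 * |t| ^ 2) * Real.exp (-c * u ^ 2)) := by
      refine intervalIntegral.norm_integral_le_of_norm_le (by linarith) ?_ ?_
      · refine Eventually.of_forall fun u hu ↦ ?_
        have hu' : u ∈ Set.Icc (-Y) Y := ⟨hu.1.le, hu.2⟩
        calc ‖F u - mainA * g u‖
            ≤ ‖mainA‖ * (K₁ * (1 + |u| ^ 3) * y ^ (-(1 / 5 : ℝ))) * Real.exp (-(a * u ^ 2)) := hF u hu'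
          _ = ‖mainA‖ * (K₁ * y ^ (-(1 / 5 : ℝ))) * ((1 + |u| ^ 3) * Real.exp (-(a * u ^ 2))) := by ring
          _ ≤ ‖mainA‖ * (K₁ * y ^ (-(1 / 5 : ℝ))) * ((2 + 32 * |t| ^ 2) * Real.exp (-c * u ^ 2)) := by
              refine mul_le_mul_of_nonneg_left (hbound_pt u) ?_
              exact mul_nonneg (norm_nonneg _) (mul_nonneg hK (Real.rpow_nonneg hy.le _))
      · exact (hh_int.const_mul _).intervalIntegrable
    refine h1.trans ?_
    rw [intervalIntegral.integral_const_mul]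
    refine mul_le_mul_of_nonneg_left ?_ (mul_nonneg (norm_nonneg _)
      (mul_nonneg hK (Real.rpow_nonneg hy.le _)))
    rw [← hh_val, intervalIntegral.integral_of_le (by linarith)]
    exact setIntegral_le_integral hh_int (Eventually.of_forall fun u ↦ by positivity)
  -- the tail
  have htail := norm_gaussian_tail_le hApos hY
  rw [← ha] at htail
  calc ‖(∫ u in (-Y)..Y, (F u - mainA * g u)) - mainA * ((∫ u : ℝ, g u) - ∫ u in (-Y)..Y, g u)‖
      ≤ ‖∫ u in (-Y)..Y, (F u - mainA * g u)‖ + ‖mainA * ((∫ u : ℝ, g u) - ∫ u in (-Y)..Y, g u)‖ :=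
        norm_sub_le _ _
    _ ≤ ‖mainA‖ * (K₁ * y ^ (-(1 / 5 : ℝ))) * Mτ +
        ‖mainA‖ * (Real.exp (-(a * Y ^ 2 / 2)) * Real.sqrt (2 * Real.pi / a)) := by
        rw [norm_mul]
        exact add_le_add herr (mul_le_mul_of_nonneg_left htail (norm_nonneg _))
    _ = _ := by rw [hMτ]; ring

/-! ## The constant `(π|t|)^{-1/2} (π/A)^{1/2}` -/

/-- **`(π|t|)^{-1/2} (π/A)^{1/2} = exp(−½ Log(1+η))`** where `|t| A = 1 + η`, `Re(1+η) > 0`.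
[folklore] -/
theorem gaussConst_eq {t : ℝ} (ht : t ≠ 0) {A η : ℂ} (hA : ((|t| : ℝ) : ℂ) * A = 1 + η)
    (hη : ‖η‖ < 1) :
    ((1 / Real.sqrt (Real.pi * |t|) : ℝ) : ℂ) * ((Real.pi : ℂ) / A) ^ (1 / 2 : ℂ) =
      Complex.exp (-(1 / 2 : ℂ) * Complex.log (1 + η)) := by
  have ht' : 0 < |t| := abs_pos.2 ht
  have hpi := Real.pi_pos
  have h1η : 1 + η ≠ 0 := by
    intro h
    have : ‖η‖ = 1 := by
      have : η = -1 := by linear_combination h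
      rw [this, norm_neg, norm_one]
    linarith
  have harg : (1 + η).arg ≠ Real.pi := by
    rw [Ne, Complex.arg_eq_pi_iff, not_and_or]
    left
    have h1 := (abs_le.1 (Complex.abs_re_le_norm η)).1
    simp only [Complex.add_re, Complex.one_re, not_lt]
    linarith
  have hA0 : A ≠ 0 := by
    intro h; rw [h, mul_zero] at hA; exact h1η hA.symm
  -- `π/A = (π|t|) · (1+η)⁻¹`
  have e1 : (Real.pi : ℂ) / A = ((Real.pi * |t| : ℝ) : ℂ) * (1 + η)⁻¹ := by
    have hτ0 : ((|t| : ℝ) : ℂ) ≠ 0 := by exact_mod_cast ht'.ne'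
    rw [← hA]; push_cast; field_simp
  rw [e1, Complex.cpow_def_of_ne_zero (mul_ne_zero (by exact_mod_cast (by positivity : Real.pi * |t| ≠ 0))
    (inv_ne_zero h1η)), Complex.log_ofReal_mul (by positivity) (inv_ne_zero h1η),
    Complex.log_inv _ harg]
  -- `c_τ = exp(-½ log(π|t|))`
  have e2 : ((1 / Real.sqrt (Real.pi * |t|) : ℝ) : ℂ) = Complex.exp (-(1 / 2 : ℂ) * (Real.log (Real.pi * |t|) : ℂ)) := by
    have : 1 / Real.sqrt (Real.pi * |t|) = Real.exp (-(1 / 2) * Real.log (Real.pi * |t|)) := by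
      rw [Real.sqrt_eq_rpow, Real.rpow_def_of_pos (by positivity), one_div, ← Real.exp_neg]
      congr 1; ring
    rw [this, Complex.ofReal_exp]; push_cast; ring_nf
  rw [e2, ← Complex.exp_add]
  congr 1; ring

/-- **`‖(π|t|)^{-1/2} (π/A)^{1/2} − 1‖ ≤ 2‖η‖`** for `‖η‖ ≤ 1/2`, where `|t| A = 1 + η`. [folklore] -/
theorem norm_gaussConst_sub_one_le {t : ℝ} (ht : t ≠ 0) {A η : ℂ} (hA : ((|t| : ℝ) : ℂ) * A = 1 + η)
    (hη : ‖η‖ ≤ 1 / 2) :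
    ‖((1 / Real.sqrt (Real.pi * |t|) : ℝ) : ℂ) * ((Real.pi : ℂ) / A) ^ (1 / 2 : ℂ) - 1‖ ≤ 2 * ‖η‖ := by
  rw [gaussConst_eq ht hA (by linarith)]
  have hlog : ‖Complex.log (1 + η)‖ ≤ 3 / 2 * ‖η‖ := Complex.norm_log_one_add_half_le_self hη
  set w : ℂ := -(1 / 2 : ℂ) * Complex.log (1 + η) with hw
  have hw1 : ‖w‖ ≤ 3 / 4 * ‖η‖ := by
    rw [hw, norm_mul, norm_neg, norm_div, norm_one, Complex.norm_ofNat]; linarith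
  have hw2 : ‖w‖ ≤ 1 := by linarith [norm_nonneg η]
  calc ‖Complex.exp w - 1‖ ≤ 2 * ‖w‖ := Complex.norm_exp_sub_one_le hw2
    _ ≤ 2 * ‖η‖ := by linarith [norm_nonneg η]


/-! ## Parts (i)/(ii), step 3: assembly; Lemma 4; `Λ ≥ 0` -/

/-! ## Auxiliary estimates for `η = |t|A − 1` -/

/-- `Re (1+η)⁻¹ ≥ 1/2` for `‖η‖ ≤ 1/10`. [folklore] -/
theorem re_inv_one_add_ge {η : ℂ} (hη : ‖η‖ ≤ 1 / 10) : 1 / 2 ≤ ((1 + η)⁻¹).re := by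
  have hre : 9 / 10 ≤ (1 + η).re := by
    have := (abs_le.1 (Complex.abs_re_le_norm η)).1
    simp only [Complex.add_re, Complex.one_re]; linarith
  have hne : 1 + η ≠ 0 := fun h ↦ by rw [h] at hre; simp at hre; linarith
  have hns : Complex.normSq (1 + η) ≤ (11 / 10) ^ 2 := by
    rw [Complex.normSq_eq_norm_sq]
    have : ‖1 + η‖ ≤ 11 / 10 := (norm_add_le _ _).trans (by rw [norm_one]; linarith)
    exact pow_le_pow_left₀ (norm_nonneg _) this 2
  have hns0 : 0 < Complex.normSq (1 + η) := Complex.normSq_pos.2 hne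
  rw [Complex.inv_re, le_div_iff₀ hns0]
  nlinarith

/-- `‖(1+η)⁻¹‖ ≤ 2` for `‖η‖ ≤ 1/2`. [folklore] -/
theorem norm_inv_one_add_le {η : ℂ} (hη : ‖η‖ ≤ 1 / 2) : ‖(1 + η)⁻¹‖ ≤ 2 := by
  have h1 : 1 / 2 ≤ ‖1 + η‖ := by
    have := norm_sub_norm_le (1 : ℂ) (-η); rw [norm_one, norm_neg, sub_neg_eq_add] at this; linarith
  rw [norm_inv]
  calc ‖1 + η‖⁻¹ ≤ (1 / 2)⁻¹ := by
        exact inv_anti₀ (by norm_num) h1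
    _ = 2 := by norm_num

/-- `‖e^{−log² n/(4A)}‖ ≤ e^{−(|t|/8) log² n}` when `|t| A = 1 + η`, `‖η‖ ≤ 1/10`
(`Re (1/(4A)) = (|t|/4) Re (1+η)⁻¹ ≥ |t|/8`). [cite: Dobner2021, proof of Lemma 4 (ii)] -/
theorem norm_cexp_neg_log_sq_div_le {t : ℝ} (ht : t ≠ 0) {A η : ℂ} (hA : ((|t| : ℝ) : ℂ) * A = 1 + η)
    (hη : ‖η‖ ≤ 1 / 10) (ℓ : ℝ) :
    ‖Complex.exp (-((ℓ : ℂ) ^ 2 / (4 * A)))‖ ≤ Real.exp (-(|t| / 8) * ℓ ^ 2) := by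
  have ht' : 0 < |t| := abs_pos.2 ht
  have hre := re_inv_one_add_ge hη
  have hne : 1 + η ≠ 0 := by
    intro h; rw [h] at hre; simp at hre; linarith
  have hτ0 : ((|t| : ℝ) : ℂ) ≠ 0 := by exact_mod_cast ht'.ne'
  have hA0 : A ≠ 0 := by intro h; rw [h, mul_zero] at hA; exact hne hA.symm
  have e : -((ℓ : ℂ) ^ 2 / (4 * A)) = ((-(ℓ ^ 2 * |t| / 4) : ℝ) : ℂ) * (1 + η)⁻¹ := by
    rw [← hA]; push_cast; field_simp
  rw [Complex.norm_exp, e, Complex.re_ofReal_mul, Real.exp_le_exp]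
  have h0 : -(ℓ ^ 2 * |t| / 4) ≤ 0 := by
    have : 0 ≤ ℓ ^ 2 * |t| / 4 := by positivity
    linarith
  nlinarith [mul_le_mul_of_nonpos_left hre h0]

/-- The exponent defect `δ = (|t|/4) log² n − log² n/(4A) = (|t| log² n/4) η (1+η)⁻¹`:
`‖δ‖ ≤ (|t| log² n / 2) ‖η‖` for `‖η‖ ≤ 1/2`. [cite: Dobner2021, proof of Lemma 4 (i)] -/
theorem norm_delta_le {t : ℝ} (ht : t ≠ 0) {A η : ℂ} (hA : ((|t| : ℝ) : ℂ) * A = 1 + η)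
    (hη : ‖η‖ ≤ 1 / 2) (ℓ : ℝ) :
    ‖((|t| / 4 * ℓ ^ 2 : ℝ) : ℂ) - (ℓ : ℂ) ^ 2 / (4 * A)‖ ≤ |t| * ℓ ^ 2 / 2 * ‖η‖ := by
  have ht' : 0 < |t| := abs_pos.2 ht
  have hne : 1 + η ≠ 0 := by
    intro h
    have : ‖η‖ = 1 := by rw [show η = -1 by linear_combination h, norm_neg, norm_one]
    linarith
  have hτ0 : ((|t| : ℝ) : ℂ) ≠ 0 := by exact_mod_cast ht'.ne'
  have hA0 : A ≠ 0 := by intro h; rw [h, mul_zero] at hA; exact hne hA.symm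
  have hA' : A = (1 + η) / ((|t| : ℝ) : ℂ) := by rw [← hA]; field_simp
  have e : ((|t| / 4 * ℓ ^ 2 : ℝ) : ℂ) - (ℓ : ℂ) ^ 2 / (4 * A) =
      ((|t| * ℓ ^ 2 / 4 : ℝ) : ℂ) * (η * (1 + η)⁻¹) := by
    rw [hA']; push_cast; field_simp; ring
  rw [e, norm_mul, Complex.norm_real, Real.norm_eq_abs, abs_of_nonneg (by positivity), norm_mul]
  have h2 := norm_inv_one_add_le hη
  calc |t| * ℓ ^ 2 / 4 * (‖η‖ * ‖(1 + η)⁻¹‖) ≤ |t| * ℓ ^ 2 / 4 * (‖η‖ * 2) := by gcongr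
    _ = |t| * ℓ ^ 2 / 2 * ‖η‖ := by ring

/-! ## The pointwise relative error on the segment `M` -/

set_option maxHeartbeats 1000000 in
/-- **Relative error on `M`** ([Dobner2021, (4.4)–(4.5)]): for `u ∈ [−Y, Y]`, `Y = y^{2/3}`,
`‖𝓘(c + iu) − main_A e^{−Au²}‖ ≤ ‖main_A‖ · 42e^{17} (1+|u|³) y^{−1/5} · e^{−(Re A) u²}`,
`main_A = γ_t(s) n^{−s} e^{−log² n/(4A)}`, under explicit largeness conditions on `y = Im s`.
[cite: Dobner2021, proof of Lemma 4, eq. (4.5)] -/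
theorem dobner_segment_bound {t : ℝ} (ht : t ≠ 0) {n : ℕ} (hn : 1 ≤ n) {s : ℂ} {C u : ℝ}
    (hy16 : 16 ≤ s.im) (hx : |s.re| ≤ C * s.im ^ (1 / 4 : ℝ)) (hC : 0 ≤ C) (hτy : |t| / 2 ≤ s.im)
    (hY : 2 * s.im ^ (2 / 3 : ℝ) ≤ s.im / 4) (h35 : s.im ^ (3 / 5 : ℝ) ≤ s.im ^ (2 / 3 : ℝ))
    (hm : 16 * (C * s.im ^ (1 / 4 : ℝ) / 2 + s.im ^ (2 / 3 : ℝ) + 3) ≤ s.im)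
    (hℓ : Real.log n ≤ s.im ^ (3 / 5 : ℝ) / |t|)
    (hu : u ∈ Set.Icc (-(s.im ^ (2 / 3 : ℝ))) (s.im ^ (2 / 3 : ℝ))) :
    ‖dobnerI t n s (dobnerCenter t n s + u * I) -
        (dobnerGammaT t s * (n : ℂ) ^ (-s) *
          Complex.exp (-((Real.log n : ℂ) ^ 2 / (4 * dobnerA t s)))) *
          Complex.exp (-dobnerA t s * (u : ℂ) ^ 2)‖ ≤
      ‖dobnerGammaT t s * (n : ℂ) ^ (-s) *
          Complex.exp (-((Real.log n : ℂ) ^ 2 / (4 * dobnerA t s)))‖ *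
        (42 * Real.exp 17 * (1 + |u| ^ 3) * s.im ^ (-(1 / 5 : ℝ))) *
        Real.exp (-((dobnerA t s).re * u ^ 2)) := by
  have ht' : 0 < |t| := abs_pos.2 ht
  have hpi4 := Real.pi_le_four
  set y : ℝ := s.im with hydef
  set x : ℝ := s.re with hxdef
  set ℓ : ℝ := Real.log n with hℓdef
  set A : ℂ := dobnerA t s with hAdef
  set lam : ℂ := dobnerShift t n s with hlam
  set Y : ℝ := y ^ (2 / 3 : ℝ) with hYdef
  set q : ℝ := y ^ (3 / 5 : ℝ) with hqdef
  set ζ : ℂ := lam + u * I with hζdef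
  set mainA : ℂ := dobnerGammaT t s * (n : ℂ) ^ (-s) * Complex.exp (-((ℓ : ℂ) ^ 2 / (4 * A)))
    with hmainA
  have hy0 : 0 < y := by linarith
  have hy1 : 1 ≤ y := by linarith
  have hq0 : 0 ≤ q := Real.rpow_nonneg hy0.le _
  have hY0 : 0 ≤ Y := Real.rpow_nonneg hy0.le _
  have hℓ0 : 0 ≤ ℓ := Real.log_natCast_nonneg n
  have hs0 : s ≠ 0 := fun h ↦ by rw [h] at hydef; simp at hydef; linarith
  have hs1 : s - 1 ≠ 0 := fun h ↦ by
    have := congrArg Complex.im h; simp at this; linarith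
  have hA0 : A ≠ 0 := dobnerA_ne_zero ht hy0 hτy
  -- the point `c + iu = s + ζ`
  have hcz : dobnerCenter t n s + u * I = s + ζ := by
    rw [dobnerCenter, hζdef, hlam]; ring
  -- sizes
  have huY : |u| ≤ Y := abs_le.2 hu
  have hlam1 : ‖lam‖ ≤ q := by
    have h1 := norm_dobnerShift_le ht (s := s) hy0 hτy n
    rw [← hlam, ← hℓdef] at h1
    calc ‖lam‖ ≤ |t| * ℓ := h1
      _ ≤ |t| * (q / |t|) := mul_le_mul_of_nonneg_left hℓ ht'.le
      _ = q := by field_simp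
  have hζ1 : ‖ζ‖ ≤ |u| + q := by
    calc ‖ζ‖ ≤ ‖lam‖ + ‖(u : ℂ) * I‖ := norm_add_le _ _
      _ = ‖lam‖ + |u| := by rw [norm_mul, Complex.norm_I, mul_one, Complex.norm_real, Real.norm_eq_abs]
      _ ≤ |u| + q := by linarith
  have hζ2 : ‖ζ‖ ≤ 2 * Y := by linarith
  have hns : y ≤ ‖s‖ := by
    have := Complex.abs_im_le_norm s; rwa [← hydef, abs_of_pos hy0] at this
  have hs2 : 2 ≤ ‖s‖ := by linarith
  have hζs : ‖ζ‖ ≤ ‖s‖ / 2 := by linarith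
  have hd : ‖ζ / 2‖ ≤ ‖s / 2‖ / 2 := by
    rw [norm_div, norm_div, Complex.norm_two]; linarith
  have hζim : |ζ.im| ≤ 2 * Y := (Complex.abs_im_le_norm ζ).trans hζ2
  have hζre : |ζ.re| ≤ 2 * Y := (Complex.abs_re_le_norm ζ).trans hζ2
  have hsζ : 0 < (s + ζ).im := by
    simp only [Complex.add_im]; rw [← hydef]; linarith [(abs_le.1 hζim).1]
  -- the `ψ − Log` bound on the segment `[s/2, (s+ζ)/2]`
  set m : ℕ := ⌈C * y ^ (1 / 4 : ℝ) / 2 + Y⌉₊ + 1 with hmdef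
  have hm0 : C * y ^ (1 / 4 : ℝ) / 2 + Y ≤ (m : ℝ) - 1 := by
    rw [hmdef]; push_cast; linarith [Nat.le_ceil (C * y ^ (1 / 4 : ℝ) / 2 + Y)]
  have hm1 : (m : ℝ) ≤ C * y ^ (1 / 4 : ℝ) / 2 + Y + 2 := by
    rw [hmdef]; push_cast
    have := Nat.ceil_lt_add_one (show 0 ≤ C * y ^ (1 / 4 : ℝ) / 2 + Y by positivity)
    linarith
  have hψ : ∀ τ' ∈ Set.Icc (0 : ℝ) 1, ‖Complex.digamma (s / 2 + τ' * (ζ / 2)) -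
      Complex.log (s / 2 + τ' * (ζ / 2))‖ ≤ 9 / y := by
    intro τ' hτ'
    have hb : (0 : ℝ) < y / 4 := by linarith
    have h₀ : y / 4 ≤ (s / 2).im := by
      simp only [Complex.div_ofNat_im]; rw [← hydef]; linarith
    have h₁ : y / 4 ≤ (s / 2 + ζ / 2).im := by
      simp only [Complex.add_im, Complex.div_ofNat_im]; rw [← hydef]
      linarith [(abs_le.1 hζim).1]
    have hr₀ : 0 < (s / 2).re + m := by
      simp only [Complex.div_ofNat_re]; rw [← hxdef]
      linarith [(abs_le.1 hx).1, Real.rpow_nonneg hy0.le (1 / 4 : ℝ)]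
    have hr₁ : 0 < (s / 2 + ζ / 2).re + m := by
      simp only [Complex.add_re, Complex.div_ofNat_re]; rw [← hxdef]
      linarith [(abs_le.1 hx).1, (abs_le.1 hζre).1]
    have h := Literature.Analysis.SpecialFunctions.Complex.norm_digamma_sub_log_le_seg (w₀ := s / 2) (d := ζ / 2) hb h₀ h₁ hr₀ hr₁ hτ'
    refine h.trans ?_
    have e1 : (Real.pi / 4 + 1) / (y / 4) ≤ 8 / y := by
      rw [div_le_div_iff₀ hb hy0]
      have h := mul_le_mul_of_nonneg_right hpi4 hy0.le
      linarith only [h]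
    have e2 : ((m : ℝ) + 1) / (y / 4) ^ 2 ≤ 1 / y := by
      rw [div_le_div_iff₀ (by positivity) hy0]
      have h16 : 16 * ((m : ℝ) + 1) ≤ y := by linarith
      have h := mul_le_mul_of_nonneg_right h16 hy0.le
      linarith only [h]
    have e3 : 8 / y + 1 / y = 9 / y := by ring
    linarith
  -- the factorisation
  obtain ⟨E, hE, hfact⟩ := dobnerI_center_eq ht hn (by rw [← hydef]; exact hy0) hsζ hd hψ
  rw [← hAdef, ← hℓdef] at hfact
  -- `‖E‖ ≤ 9‖ζ‖/(2y) + ‖ζ‖³/y²` and `‖E‖ ≤ 17`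
  have hE1 : ‖E‖ ≤ 9 / (2 * y) * ‖ζ‖ + ‖ζ‖ ^ 3 / y ^ 2 := by
    have e1 : ‖ζ / 2‖ = ‖ζ‖ / 2 := by rw [norm_div, Complex.norm_two]
    have e2 : ‖s / 2‖ = ‖s‖ / 2 := by rw [norm_div, Complex.norm_two]
    rw [e1, e2] at hE
    have h3 : 2 * (‖ζ‖ / 2) ^ 3 / (‖s‖ / 2) ^ 2 = ‖ζ‖ ^ 3 / ‖s‖ ^ 2 := by
      field_simp
    rw [h3] at hE
    have h4 : ‖ζ‖ ^ 3 / ‖s‖ ^ 2 ≤ ‖ζ‖ ^ 3 / y ^ 2 :=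
      div_le_div_of_nonneg_left (by positivity) (by positivity) (pow_le_pow_left₀ hy0.le hns 2)
    have h5 : 9 / y * (‖ζ‖ / 2) = 9 / (2 * y) * ‖ζ‖ := by field_simp
    linarith
  have hY3 : Y ^ 3 = y ^ 2 := by
    rw [hYdef, ← Real.rpow_natCast, ← Real.rpow_mul hy0.le]; norm_num
  have hE17 : ‖E‖ ≤ 17 := by
    have h1 : 9 / (2 * y) * ‖ζ‖ ≤ 9 := by
      rw [div_mul_eq_mul_div, div_le_iff₀ (by positivity)]; linarith only [hζ2, hY, hy0]
    have h2 : ‖ζ‖ ^ 3 / y ^ 2 ≤ 8 := by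
      rw [div_le_iff₀ (by positivity)]
      calc ‖ζ‖ ^ 3 ≤ (2 * Y) ^ 3 := pow_le_pow_left₀ (norm_nonneg _) hζ2 3
        _ = 8 * y ^ 2 := by rw [mul_pow, hY3]; norm_num
    linarith
  -- `‖Q − 1‖`
  have hQ := norm_Q_sub_one_le (E := E) hs2 hζs hs0 hs1
  -- numerics: `e^{‖E‖}(4‖ζ‖/‖s‖ + 2‖E‖) ≤ 42 e^{17} (1+|u|³) y^{-1/5}`
  set w : ℝ := y ^ (-(1 / 5 : ℝ)) with hwdef
  have hw0 : 0 < w := Real.rpow_pos_of_pos hy0 _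
  set U : ℝ := |u| with hUdef
  have hU0 : 0 ≤ U := abs_nonneg u
  have hnum : 4 * ‖ζ‖ / ‖s‖ + 2 * ‖E‖ ≤ 42 * (1 + U ^ 3) * w := by
    -- basic comparisons of powers of `y`
    have i1 : 1 / y ≤ w := by
      rw [hwdef, one_div, ← Real.rpow_neg_one]
      exact Real.rpow_le_rpow_of_exponent_le hy1 (by norm_num)
    have i2 : 1 / y ^ 2 ≤ w := by
      have : 1 / y ^ 2 ≤ 1 / y := by
        rw [div_le_div_iff₀ (by positivity) hy0]
        have h := mul_le_mul_of_nonneg_left hy1 hy0.le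
        linarith only [h]
      exact this.trans i1
    have i3 : q / y ≤ w := by
      rw [hqdef, hwdef, div_eq_mul_inv, ← Real.rpow_neg_one, ← Real.rpow_add hy0]
      exact Real.rpow_le_rpow_of_exponent_le hy1 (by norm_num)
    have i4 : q ^ 3 / y ^ 2 = w := by
      have e1 : q ^ 3 = y ^ (9 / 5 : ℝ) := by
        rw [hqdef, ← Real.rpow_natCast _ 3, ← Real.rpow_mul hy0.le]; norm_num
      have e2 : y ^ 2 = y ^ (2 : ℝ) := (Real.rpow_two y).symm
      rw [e1, e2, hwdef, ← Real.rpow_sub hy0]; norm_num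
    have hU1 : U ≤ 1 + U ^ 3 := by
      rcases le_or_gt U 1 with h | h
      · linarith [pow_nonneg hU0 3]
      · have h2 : U * 1 ≤ U * U ^ 2 :=
          mul_le_mul_of_nonneg_left (one_le_pow₀ h.le) hU0
        have h3 : U * U ^ 2 = U ^ 3 := by ring
        linarith
    -- `4‖ζ‖/‖s‖ ≤ 4(U+q)/y`
    have j1 : 4 * ‖ζ‖ / ‖s‖ ≤ 4 * (U + q) * (1 / y) := by
      rw [mul_one_div, div_le_div_iff₀ (by linarith) hy0]
      have := mul_le_mul hζ1 hns hy0.le (by positivity)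
      linarith
    -- `2‖E‖ ≤ 9(U+q)/y + 8(U³+q³)/y²`
    have j2 : 2 * ‖E‖ ≤ 9 * (U + q) * (1 / y) + 8 * (U ^ 3 + q ^ 3) * (1 / y ^ 2) := by
      have h1 : ‖ζ‖ ^ 3 ≤ (U + q) ^ 3 := pow_le_pow_left₀ (norm_nonneg _) hζ1 3
      have h2 : (U + q) ^ 3 ≤ 4 * (U ^ 3 + q ^ 3) := by
        -- `4(U³+q³) − (U+q)³ = 3(U+q)(U−q)²`
        have key : 0 ≤ (U + q) * (U - q) ^ 2 :=
          mul_nonneg (add_nonneg hU0 hq0) (sq_nonneg (U - q))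
        linarith only [key]
      have h3 : ‖ζ‖ ^ 3 / y ^ 2 ≤ 4 * (U ^ 3 + q ^ 3) * (1 / y ^ 2) := by
        rw [mul_one_div, div_le_div_iff_of_pos_right (by positivity)]; linarith
      have h4 : 9 / (2 * y) * ‖ζ‖ ≤ 9 / 2 * (U + q) * (1 / y) := by
        rw [mul_one_div, div_mul_eq_mul_div, div_le_div_iff₀ (by positivity) hy0]
        have h := mul_le_mul_of_nonneg_right hζ1 hy0.le
        linarith only [h]
      linarith
    -- combine
    have k1 : (U + q) * (1 / y) ≤ (1 + U ^ 3) * w + w := by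
      have e : (U + q) * (1 / y) = U * (1 / y) + q / y := by ring
      rw [e]
      have : U * (1 / y) ≤ (1 + U ^ 3) * w := mul_le_mul hU1 i1 (by positivity) (by positivity)
      linarith
    have k2 : (U ^ 3 + q ^ 3) * (1 / y ^ 2) ≤ U ^ 3 * w + w := by
      have e : (U ^ 3 + q ^ 3) * (1 / y ^ 2) = U ^ 3 * (1 / y ^ 2) + q ^ 3 / y ^ 2 := by ring
      rw [e, i4]
      have : U ^ 3 * (1 / y ^ 2) ≤ U ^ 3 * w := mul_le_mul_of_nonneg_left i2 (by positivity)
      linarith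
    have hU3 : 0 ≤ U ^ 3 := pow_nonneg hU0 3
    have hUw : 0 ≤ U ^ 3 * w := mul_nonneg hU3 hw0.le
    linarith only [j1, j2, k1, k2, hUw, hw0.le]
  have hQ1 : ‖(s + ζ) * (s + ζ - 1) / (s * (s - 1)) * Complex.exp E - 1‖ ≤
      42 * Real.exp 17 * (1 + U ^ 3) * w := by
    refine hQ.trans ?_
    have h1 : Real.exp ‖E‖ ≤ Real.exp 17 := Real.exp_le_exp.2 hE17
    have h2 : 0 ≤ 4 * ‖ζ‖ / ‖s‖ + 2 * ‖E‖ := by positivity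
    calc Real.exp ‖E‖ * (4 * ‖ζ‖ / ‖s‖ + 2 * ‖E‖) ≤ Real.exp 17 * (42 * (1 + U ^ 3) * w) :=
          mul_le_mul h1 hnum h2 (Real.exp_pos _).le
      _ = _ := by ring
  -- rewrite the integrand
  have hexp : Complex.exp (A * ζ ^ 2 - (ℓ : ℂ) * ζ) =
      Complex.exp (-((ℓ : ℂ) ^ 2 / (4 * A))) * Complex.exp (-A * (u : ℂ) ^ 2) := by
    rw [← Complex.exp_add, hζdef, hlam, hAdef, hℓdef, dobnerA_sq_sub_on_segment hA0 n u, neg_mul]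
  have hI : dobnerI t n s (dobnerCenter t n s + u * I) =
      mainA * Complex.exp (-A * (u : ℂ) ^ 2) *
        ((s + ζ) * (s + ζ - 1) / (s * (s - 1)) * Complex.exp E) := by
    rw [hcz, hfact, hexp, hmainA]; ring
  rw [hI]
  have e : mainA * Complex.exp (-A * (u : ℂ) ^ 2) * ((s + ζ) * (s + ζ - 1) / (s * (s - 1)) * Complex.exp E) -
      mainA * Complex.exp (-A * (u : ℂ) ^ 2) =
      mainA * Complex.exp (-A * (u : ℂ) ^ 2) *
        ((s + ζ) * (s + ζ - 1) / (s * (s - 1)) * Complex.exp E - 1) := by ring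
  rw [e, norm_mul, norm_mul, norm_cexp_neg_mul_sq]
  have h0 : 0 ≤ ‖mainA‖ * Real.exp (-A.re * u ^ 2) := by positivity
  calc ‖mainA‖ * Real.exp (-A.re * u ^ 2) * ‖(s + ζ) * (s + ζ - 1) / (s * (s - 1)) * Complex.exp E - 1‖
      ≤ ‖mainA‖ * Real.exp (-A.re * u ^ 2) * (42 * Real.exp 17 * (1 + U ^ 3) * w) :=
        mul_le_mul_of_nonneg_left hQ1 h0
    _ = _ := by rw [hUdef, hwdef, neg_mul]; ring

/-! ## Parts (i) and (ii) -/

set_option maxHeartbeats 8000000 in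
/-- **Dobner's Lemma 4 (i), (ii)** for `F = ζ` and fixed `t < 0`, `C > 0`: there are `y₀` and
`K > 0` such that for `|Re s| ≤ C (Im s)^{1/4}`, `Im s ≥ y₀`, `n ≥ 1`:
(i) if `log n ≤ (Im s)^{1/3}/|t|` then `‖B_{t,n}(s) − main‖ ≤ K (Im s)^{−1/5} ‖main‖`;
(ii) if `log n ≤ (Im s)^{3/5}/|t|` then `‖B_{t,n}(s)‖ ≤ K ‖γ_t(s)‖ e^{−(|t|/8) log² n} n^{−Re s}`.
[cite: Dobner2021, Lemma 4 (i),(ii)] -/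
theorem dobner_lemma4_smallmedium {t : ℝ} (ht : t < 0) {C : ℝ} (hC : 0 < C) :
    ∃ y₀ K : ℝ, 0 < K ∧ ∀ s : ℂ, |s.re| ≤ C * s.im ^ (1 / 4 : ℝ) → y₀ ≤ s.im → ∀ n : ℕ, 1 ≤ n →
      (Real.log n ≤ s.im ^ (1 / 3 : ℝ) / |t| →
        ‖dobnerB t n s - dobnerMainTerm t n s‖ ≤
          K * s.im ^ (-(1 / 5 : ℝ)) * ‖dobnerMainTerm t n s‖) ∧
      (Real.log n ≤ s.im ^ (3 / 5 : ℝ) / |t| →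
        ‖dobnerB t n s‖ ≤ K * ‖dobnerGammaT t s‖ * Real.exp (-(|t| / 8) * Real.log n ^ 2) *
          (n : ℝ) ^ (-s.re)) := by
  have ht0 : t ≠ 0 := ht.ne
  have hτ : 0 < |t| := abs_pos.2 ht0
  set τ : ℝ := |t| with hτdef
  have hpi := Real.pi_gt_three
  have hpi4 := Real.pi_le_four
  set cτ : ℝ := 1 / Real.sqrt (Real.pi * τ) with hcτ
  have hcτ0 : 0 < cτ := by positivity
  set Mτ : ℝ := (2 + 32 * τ ^ 2) * Real.sqrt (4 * Real.pi * τ) with hMτ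
  have hMτ0 : 0 ≤ Mτ := by positivity
  set Sτ : ℝ := Real.sqrt (4 * Real.pi * τ) with hSτ
  have hSτ0 : 0 < Sτ := by positivity
  set K₁ : ℝ := 42 * Real.exp 17 with hK₁
  have hK₁0 : 0 ≤ K₁ := by positivity
  -- the constant
  set K : ℝ := 4 + 2 * cτ * (K₁ * Mτ + Sτ + 1) with hKdef
  have hK0 : 0 < K := by positivity
  -- inputs: the contour step and the lower bound for `γ`
  obtain ⟨y₁, hy₁⟩ := dobner_lemma4_contour ht C
  obtain ⟨y₂, hy₂⟩ := exists_exp_neg_four_mul_le_norm_xiGammaFactor hC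
  -- largeness conditions
  have evA : ∀ᶠ y : ℝ in atTop, y₁ ≤ y ∧ y₂ ≤ y ∧ 16 ≤ y ∧ 3 * τ ≤ y := by
    filter_upwards [eventually_ge_atTop y₁, eventually_ge_atTop y₂, eventually_ge_atTop (16 : ℝ),
      eventually_ge_atTop (3 * τ)] with y h1 h2 h3 h4
    exact ⟨h1, h2, h3, h4⟩
  have evB : ∀ᶠ y : ℝ in atTop, 2 * y ^ (2 / 3 : ℝ) ≤ y / 4 ∧ y ^ (3 / 5 : ℝ) ≤ y ^ (2 / 3 : ℝ) ∧
      16 * (C * y ^ (1 / 4 : ℝ) / 2 + y ^ (2 / 3 : ℝ) + 3) ≤ y ∧ τ / 2 ≤ y ^ (4 / 5 : ℝ) := by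
    filter_upwards [eventually_const_mul_rpow_le_rpow 8 (by norm_num : (2 / 3 : ℝ) < 1),
      eventually_const_mul_rpow_le_rpow 1 (by norm_num : (3 / 5 : ℝ) < 2 / 3),
      eventually_const_mul_rpow_le_rpow (3 * (16 * (C / 2))) (by norm_num : (1 / 4 : ℝ) < 1),
      eventually_const_mul_rpow_le_rpow (3 * 16) (by norm_num : (2 / 3 : ℝ) < 1),
      eventually_ge_atTop (3 * 48 : ℝ),
      eventually_const_le_rpow (τ / 2) (by norm_num : (0 : ℝ) < 4 / 5)] with y h1 h2 h3 h4 h5 h6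
    rw [Real.rpow_one] at h1 h3 h4
    rw [one_mul] at h2
    exact ⟨by linarith, h2, by linarith, h6⟩
  have evC : ∀ᶠ y : ℝ in atTop,
      (1 / 5 * Real.log y + 4 * y + Real.pi ^ 2 * τ / 16 + C * y ^ (17 / 20 : ℝ) / τ +
        y ^ (6 / 5 : ℝ) / (4 * τ) ≤ y ^ (4 / 3 : ℝ) / (18 * τ)) ∧
      (Real.log Sτ + 1 / 5 * Real.log y ≤ y ^ (4 / 3 : ℝ) / (4 * τ)) := by
    filter_upwards [eventually_const_mul_log_le_rpow (90 * τ * (1 / 5)) (by norm_num : (0 : ℝ) < 4 / 3),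
      eventually_const_mul_rpow_le_rpow (90 * τ * 4) (by norm_num : (1 : ℝ) < 4 / 3),
      eventually_const_le_rpow (90 * τ * (Real.pi ^ 2 * τ / 16)) (by norm_num : (0 : ℝ) < 4 / 3),
      eventually_const_mul_rpow_le_rpow (90 * C) (by norm_num : (17 / 20 : ℝ) < 4 / 3),
      eventually_const_mul_rpow_le_rpow (90 / 4) (by norm_num : (6 / 5 : ℝ) < 4 / 3),
      eventually_const_le_rpow (8 * τ * Real.log Sτ) (by norm_num : (0 : ℝ) < 4 / 3),
      eventually_const_mul_log_le_rpow (8 * τ * (1 / 5)) (by norm_num : (0 : ℝ) < 4 / 3)]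
      with y h1 h2 h3 h4 h5 h6 h7
    rw [Real.rpow_one] at h2
    constructor
    · rw [le_div_iff₀ (by positivity)]
      have e : (1 / 5 * Real.log y + 4 * y + Real.pi ^ 2 * τ / 16 + C * y ^ (17 / 20 : ℝ) / τ +
          y ^ (6 / 5 : ℝ) / (4 * τ)) * (18 * τ) =
          18 * τ * (1 / 5) * Real.log y + 18 * τ * 4 * y + 18 * τ * (Real.pi ^ 2 * τ / 16) +
            18 * C * y ^ (17 / 20 : ℝ) + 18 / 4 * y ^ (6 / 5 : ℝ) := by
        field_simp
      rw [e]; linarith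
    · rw [le_div_iff₀ (by positivity)]; linarith
  obtain ⟨y₀, hy₀⟩ := eventually_atTop.1 ((evA.and evB).and evC)
  refine ⟨y₀, K, hK0, fun s hx hy n hn ↦ ?_⟩
  obtain ⟨⟨⟨hyy₁, hyy₂, hy16, hy3τ⟩, ⟨hY4, h3523, hm16, hτ45⟩⟩, habs, htailc⟩ := hy₀ s.im hy
  clear hy₀ evA evB evC
  -- notation
  set y : ℝ := s.im with hydef
  set x : ℝ := s.re with hxdef
  set ℓ : ℝ := Real.log n with hℓdef
  set A : ℂ := dobnerA t s with hAdef
  set η : ℂ := ((τ : ℝ) : ℂ) * A - 1 with hηdef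
  set c : ℂ := dobnerCenter t n s with hcdef
  set Y : ℝ := y ^ (2 / 3 : ℝ) with hYdef
  set q : ℝ := y ^ (3 / 5 : ℝ) with hqdef
  set mainA : ℂ := dobnerGammaT t s * (n : ℂ) ^ (-s) * Complex.exp (-((ℓ : ℂ) ^ 2 / (4 * A)))
    with hmainA
  set main : ℂ := dobnerMainTerm t n s with hmain
  set Pg : ℂ := ((Real.pi : ℂ) / A) ^ (1 / 2 : ℂ) with hPg
  set g : ℂ := ((cτ : ℝ) : ℂ) * Pg with hgdef
  set W : ℝ := ‖dobnerGammaT t s‖ * Real.exp (-(τ / 8) * ℓ ^ 2) * (n : ℝ) ^ (-x) with hWdef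
  set W' : ℝ := ‖dobnerGammaT t s‖ * Real.exp (-(τ / 4) * ℓ ^ 2) * (n : ℝ) ^ (-x) with hW'def
  set tail : ℝ := Real.exp (-(A.re * Y ^ 2 / 2)) * Real.sqrt (2 * Real.pi / A.re) with htail
  set Δ : ℝ := Real.exp (-(y ^ (4 / 3 : ℝ) / (18 * τ))) with hΔ
  set w : ℝ := y ^ (-(1 / 5 : ℝ)) with hwdef
  have hy0 : 0 < y := by linarith
  have hy1 : 1 ≤ y := by linarith
  have hY0 : 0 ≤ Y := Real.rpow_nonneg hy0.le _
  have hq0 : 0 ≤ q := Real.rpow_nonneg hy0.le _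
  have hℓ0 : 0 ≤ ℓ := Real.log_natCast_nonneg n
  have hn0 : (0 : ℝ) < n := by exact_mod_cast hn
  have hs0 : s ≠ 0 := fun h ↦ by rw [h] at hydef; simp at hydef; linarith
  have hτy : τ / 2 ≤ y := by linarith
  have hw0 : 0 < w := Real.rpow_pos_of_pos hy0 _
  have hw1 : w ≤ 1 := Real.rpow_le_one_of_one_le_of_nonpos hy1 (by norm_num)
  have hWn : 0 ≤ W := by rw [hWdef]; positivity
  have hW'n : 0 ≤ W' := by rw [hW'def]; positivity
  -- `η`
  have hAη : ((τ : ℝ) : ℂ) * A = 1 + η := by rw [hηdef]; ring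
  have hη : ‖η‖ ≤ τ / (4 * y) := by
    have e : η = ((τ : ℝ) : ℂ) * (1 / (4 * s)) := by
      have h0 : ((|t| : ℝ) : ℂ) ≠ 0 := by exact_mod_cast (abs_pos.2 ht0).ne'
      rw [hηdef, hAdef, dobnerA, hτdef]; push_cast; field_simp; ring
    rw [e, norm_mul, Complex.norm_real, Real.norm_eq_abs, abs_of_pos hτ]
    calc τ * ‖1 / (4 * s)‖ ≤ τ * (1 / (4 * y)) :=
          mul_le_mul_of_nonneg_left (norm_inv_four_mul_le hy0) hτ.le
      _ = τ / (4 * y) := by ring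
  have hη10 : ‖η‖ ≤ 1 / 10 := by
    refine hη.trans ?_
    rw [div_le_div_iff₀ (by positivity) (by norm_num)]; linarith
  have hη2 : ‖η‖ ≤ 1 / 2 := by linarith
  have hηw : 2 * ‖η‖ ≤ w := by
    have e : w = y ^ (4 / 5 : ℝ) / y := by
      rw [hwdef, ← Real.rpow_sub_one hy0.ne']; norm_num
    rw [e, le_div_iff₀ hy0]
    calc 2 * ‖η‖ * y ≤ 2 * (τ / (4 * y)) * y := by gcongr
      _ = τ / 2 := by field_simp; ring
      _ ≤ y ^ (4 / 5 : ℝ) := hτ45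
  have hAre : 1 / (2 * τ) ≤ A.re := dobnerA_re_ge ht0 hy0 hτy
  have hApos : 0 < A.re := lt_of_lt_of_le (by positivity) hAre
  have hg1 : ‖g - 1‖ ≤ 2 * ‖η‖ := norm_gaussConst_sub_one_le ht0 hAη hη2
  have hg2 : ‖g‖ ≤ 2 := by
    calc ‖g‖ = ‖(g - 1) + 1‖ := by rw [sub_add_cancel]
      _ ≤ ‖g - 1‖ + ‖(1 : ℂ)‖ := norm_add_le _ _
      _ ≤ 2 * ‖η‖ + 1 := by rw [norm_one]; linarith
      _ ≤ 2 := by linarith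
  -- norms of `main_A`, `main`
  have hWle : ‖mainA‖ ≤ W := by
    rw [hmainA, norm_mul, norm_mul, Complex.norm_natCast_cpow_of_pos (by omega), Complex.neg_re,
      ← hxdef, hWdef]
    have h1 := norm_cexp_neg_log_sq_div_le ht0 hAη hη10 ℓ
    rw [← hτdef] at h1
    calc ‖dobnerGammaT t s‖ * (n : ℝ) ^ (-x) * ‖Complex.exp (-((ℓ : ℂ) ^ 2 / (4 * A)))‖
        ≤ ‖dobnerGammaT t s‖ * (n : ℝ) ^ (-x) * Real.exp (-(τ / 8) * ℓ ^ 2) := by gcongr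
      _ = _ := by ring
  have hmain_norm : ‖main‖ = W' := by
    rw [hmain, norm_dobnerMainTerm_eq ht hs0 hn, hW'def, ← hℓdef, ← hxdef, ← hτdef]; ring
  have hW'W : W' ≤ W := by
    rw [hWdef, hW'def]
    have hτℓ : 0 ≤ τ * ℓ ^ 2 := by positivity
    have : Real.exp (-(τ / 4) * ℓ ^ 2) ≤ Real.exp (-(τ / 8) * ℓ ^ 2) :=
      Real.exp_le_exp.2 (by linarith only [hτℓ])
    have h0 : 0 ≤ (n : ℝ) ^ (-x) := Real.rpow_nonneg n.cast_nonneg _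
    gcongr
  have htailS : tail ≤ Real.exp (-(y ^ (4 / 3 : ℝ) / (4 * τ))) * Sτ := by
    have h1 : Real.exp (-(A.re * Y ^ 2 / 2)) ≤ Real.exp (-(y ^ (4 / 3 : ℝ) / (4 * τ))) := by
      rw [Real.exp_le_exp]
      have e : Y ^ 2 = y ^ (4 / 3 : ℝ) := by
        rw [hYdef, ← Real.rpow_natCast _ 2, ← Real.rpow_mul hy0.le]; norm_num
      rw [← e]
      have : 1 / (2 * τ) * Y ^ 2 / 2 ≤ A.re * Y ^ 2 / 2 := by gcongr
      have e2 : 1 / (2 * τ) * Y ^ 2 / 2 = Y ^ 2 / (4 * τ) := by field_simp; ring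
      linarith
    have h2 : Real.sqrt (2 * Real.pi / A.re) ≤ Sτ := by
      rw [hSτ]
      refine Real.sqrt_le_sqrt ?_
      rw [div_le_iff₀ hApos]
      calc 2 * Real.pi = 4 * Real.pi * τ * (1 / (2 * τ)) := by field_simp; ring
        _ ≤ 4 * Real.pi * τ * A.re := by gcongr
    rw [htail]; exact mul_le_mul h1 h2 (Real.sqrt_nonneg _) (Real.exp_pos _).le
  have htail1 : tail ≤ w := by
    refine htailS.trans ?_
    rw [hwdef, Real.rpow_def_of_pos hy0 (-(1 / 5 : ℝ)),
      show Sτ = Real.exp (Real.log Sτ) by rw [Real.exp_log hSτ0], ← Real.exp_add, Real.exp_le_exp]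
    linarith
  have htail2 : tail ≤ Sτ := by
    refine htailS.trans ?_
    have : Real.exp (-(y ^ (4 / 3 : ℝ) / (4 * τ))) ≤ 1 := by
      rw [Real.exp_le_one_iff]
      have : 0 ≤ y ^ (4 / 3 : ℝ) / (4 * τ) := by positivity
      linarith
    calc Real.exp (-(y ^ (4 / 3 : ℝ) / (4 * τ))) * Sτ ≤ 1 * Sτ :=
          mul_le_mul_of_nonneg_right this hSτ0.le
      _ = Sτ := one_mul _
  -- core estimate in the regime `log n ≤ y^{3/5}/τ`
  have core : ℓ ≤ q / τ →
      ‖dobnerB t n s - mainA * g‖ ≤ Δ + cτ * (‖mainA‖ * (K₁ * w * Mτ + tail)) ∧ Δ ≤ w * W' := by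
    intro hreg
    -- the contour step
    have hcont := hy₁ s hx hyy₁ n hn hreg
    rw [← hydef, ← hcdef, ← hτdef, ← hcτ, ← hYdef, ← hΔ] at hcont
    -- the segment
    have hlam1 : ‖dobnerShift t n s‖ ≤ q := by
      have h1 := norm_dobnerShift_le ht0 (s := s) hy0 hτy n
      calc ‖dobnerShift t n s‖ ≤ τ * ℓ := h1
        _ ≤ τ * (q / τ) := mul_le_mul_of_nonneg_left hreg hτ.le
        _ = q := by field_simp
    have hcim : y - q ≤ c.im := by
      rw [hcdef, dobnerCenter, Complex.add_im, ← hydef]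
      linarith [(abs_le.1 ((Complex.abs_im_le_norm _).trans hlam1)).1]
    have hseg : ∀ u ∈ Set.Icc (-Y) Y,
        ‖dobnerI t n s (c + u * I) - mainA * Complex.exp (-A * (u : ℂ) ^ 2)‖ ≤
          ‖mainA‖ * (K₁ * (1 + |u| ^ 3) * w) * Real.exp (-(A.re * u ^ 2)) := by
      intro u hu
      exact dobner_segment_bound ht0 hn (s := s) (C := C) (u := u) hy16 hx hC.le hτy hY4 h3523
        hm16 hreg hu
    have hFi : IntervalIntegrable (fun u : ℝ ↦ dobnerI t n s (c + u * I)) volume (-Y) Y := by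
      refine ContinuousOn.intervalIntegrable fun u hu ↦ ?_
      rw [Set.uIcc_of_le (by linarith)] at hu
      refine (continuousAt_dobnerI_comp (t := t) hn s (g := fun u : ℝ ↦ c + u * I) (by fun_prop)
        (Or.inr ?_)).continuousWithinAt
      have e : (c + u * I).im = c.im + u := by simp
      rw [e]
      have := hu.1
      exact (show (0 : ℝ) < c.im + u by linarith).ne'
    have hM := dobner_M_estimate ht0 (F := fun u : ℝ ↦ dobnerI t n s (c + u * I)) (A := A)
      (mainA := mainA) hY0 hK₁0 hy0 hAre hFi hseg
    rw [← hτdef, ← hMτ, ← htail, ← hPg] at hM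
    constructor
    · have e : dobnerB t n s - mainA * g =
          (dobnerB t n s - ((cτ : ℝ) : ℂ) * ∫ u in (-Y)..Y, dobnerI t n s (c + u * I)) +
            ((cτ : ℝ) : ℂ) * ((∫ u in (-Y)..Y, dobnerI t n s (c + u * I)) - mainA * Pg) := by
        rw [hgdef]; ring
      rw [e]
      calc _ ≤ ‖dobnerB t n s - ((cτ : ℝ) : ℂ) * ∫ u in (-Y)..Y, dobnerI t n s (c + u * I)‖ +
            ‖((cτ : ℝ) : ℂ) * ((∫ u in (-Y)..Y, dobnerI t n s (c + u * I)) - mainA * Pg)‖ :=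
            norm_add_le _ _
        _ ≤ Δ + cτ * (‖mainA‖ * (K₁ * w * Mτ + tail)) := by
            refine add_le_add hcont ?_
            rw [norm_mul, Complex.norm_real, Real.norm_eq_abs, abs_of_pos hcτ0]
            exact mul_le_mul_of_nonneg_left hM hcτ0.le
    · -- absorption of `Δ`
      have hγ := hy₂ s hx hyy₂
      rw [← hydef] at hγ
      have hγt := norm_xiGammaFactor_le_norm_dobnerGammaT t s
      rw [← hτdef] at hγt
      have h1 : Real.exp (-(Real.pi ^ 2 * τ / 16)) * Real.exp (-4 * y) ≤ ‖dobnerGammaT t s‖ :=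
        (mul_le_mul_of_nonneg_left hγ (Real.exp_pos _).le).trans hγt
      have h2 : Real.exp (-(y ^ (6 / 5 : ℝ) / (4 * τ))) ≤ Real.exp (-(τ / 4) * ℓ ^ 2) := by
        rw [Real.exp_le_exp]
        have hℓq : ℓ ^ 2 ≤ (q / τ) ^ 2 := pow_le_pow_left₀ hℓ0 hreg 2
        have e : y ^ (6 / 5 : ℝ) = q ^ 2 := by
          rw [hqdef, ← Real.rpow_natCast _ 2, ← Real.rpow_mul hy0.le]; norm_num
        rw [e]
        have : τ / 4 * ℓ ^ 2 ≤ τ / 4 * (q / τ) ^ 2 := mul_le_mul_of_nonneg_left hℓq (by positivity)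
        have e2 : τ / 4 * (q / τ) ^ 2 = q ^ 2 / (4 * τ) := by field_simp
        linarith
      have h3 : Real.exp (-(C * y ^ (17 / 20 : ℝ) / τ)) ≤ (n : ℝ) ^ (-x) := by
        rw [Real.rpow_def_of_pos hn0, ← hℓdef, Real.exp_le_exp]
        have e : y ^ (17 / 20 : ℝ) = y ^ (1 / 4 : ℝ) * q := by
          rw [hqdef, ← Real.rpow_add hy0]; norm_num
        rw [e]
        have hxℓ : x * ℓ ≤ |x| * ℓ := mul_le_mul_of_nonneg_right (le_abs_self x) hℓ0
        have h4 : |x| * ℓ ≤ C * y ^ (1 / 4 : ℝ) * (q / τ) := mul_le_mul hx hreg hℓ0 (by positivity)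
        have e2 : C * y ^ (1 / 4 : ℝ) * (q / τ) = C * (y ^ (1 / 4 : ℝ) * q) / τ := by ring
        linarith
      have h4 : w = Real.exp (-(1 / 5 * Real.log y)) := by
        rw [hwdef, Real.rpow_def_of_pos hy0]; ring_nf
      have hprod : Δ ≤ Real.exp (-(1 / 5 * Real.log y)) *
          ((Real.exp (-(Real.pi ^ 2 * τ / 16)) * Real.exp (-4 * y)) *
            Real.exp (-(y ^ (6 / 5 : ℝ) / (4 * τ))) * Real.exp (-(C * y ^ (17 / 20 : ℝ) / τ))) := by
        rw [hΔ, ← Real.exp_add, ← Real.exp_add, ← Real.exp_add, ← Real.exp_add, Real.exp_le_exp]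
        linarith
      refine hprod.trans ?_
      rw [h4, hW'def]
      refine mul_le_mul_of_nonneg_left ?_ (Real.exp_pos _).le
      have i1 : Real.exp (-(Real.pi ^ 2 * τ / 16)) * Real.exp (-4 * y) *
          Real.exp (-(y ^ (6 / 5 : ℝ) / (4 * τ))) ≤ ‖dobnerGammaT t s‖ * Real.exp (-(τ / 4) * ℓ ^ 2) :=
        mul_le_mul h1 h2 (Real.exp_pos _).le (norm_nonneg _)
      have i2 := mul_le_mul i1 h3 (Real.exp_pos _).le (mul_nonneg (norm_nonneg _) (Real.exp_pos _).le)
      exact i2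
  constructor
  · -- part (i)
    intro hℓ13
    have hreg : ℓ ≤ q / τ := by
      refine hℓ13.trans (div_le_div_of_nonneg_right ?_ hτ.le)
      exact Real.rpow_le_rpow_of_exponent_le hy1 (by norm_num)
    obtain ⟨hcore, hΔW⟩ := core hreg
    -- `main_A = main · e^δ`
    set δ : ℂ := ((τ / 4 * ℓ ^ 2 : ℝ) : ℂ) - (ℓ : ℂ) ^ 2 / (4 * A) with hδdef
    have hmainAeq : mainA = main * Complex.exp δ := by
      have e1 : Complex.exp (-((ℓ : ℂ) ^ 2 / (4 * A))) =
          Complex.exp ((-(τ / 4 * ℓ ^ 2) : ℝ) : ℂ) * Complex.exp δ := by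
        rw [← Complex.exp_add]; congr 1; rw [hδdef]; push_cast; ring
      rw [hmainA, e1, hmain, dobnerMainTerm, ← hτdef, ← hℓdef]; push_cast; ring
    have hδ : ‖δ‖ ≤ w / 8 := by
      have h1 := norm_delta_le ht0 hAη hη2 ℓ
      rw [← hτdef] at h1
      have h2 : τ * ℓ ^ 2 / 2 * ‖η‖ ≤ τ * ℓ ^ 2 / 2 * (τ / (4 * y)) :=
        mul_le_mul_of_nonneg_left hη (by positivity)
      have h3 : τ ^ 2 * ℓ ^ 2 ≤ y ^ (2 / 3 : ℝ) := by
        have h31 : τ * ℓ ≤ y ^ (1 / 3 : ℝ) := by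
          rw [← le_div_iff₀' hτ]; exact hℓ13
        have h0 : 0 ≤ τ * ℓ := by positivity
        calc τ ^ 2 * ℓ ^ 2 = (τ * ℓ) ^ 2 := by ring
          _ ≤ (y ^ (1 / 3 : ℝ)) ^ 2 := pow_le_pow_left₀ h0 h31 2
          _ = y ^ (2 / 3 : ℝ) := by rw [← Real.rpow_natCast _ 2, ← Real.rpow_mul hy0.le]; norm_num
      have h4 : y ^ (2 / 3 : ℝ) / y ≤ w := by
        rw [← Real.rpow_sub_one hy0.ne', hwdef]
        exact Real.rpow_le_rpow_of_exponent_le hy1 (by norm_num)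
      have h5 : τ ^ 2 * ℓ ^ 2 / y ≤ y ^ (2 / 3 : ℝ) / y := div_le_div_of_nonneg_right h3 hy0.le
      calc ‖δ‖ ≤ τ * ℓ ^ 2 / 2 * (τ / (4 * y)) := h1.trans h2
        _ = τ ^ 2 * ℓ ^ 2 / y / 8 := by field_simp; ring
        _ ≤ w / 8 := by linarith
    have hδ1 : ‖δ‖ ≤ 1 / 8 := by linarith
    have hexpn : Real.exp ‖δ‖ ≤ 5 / 4 := by
      have h := Real.abs_exp_sub_one_le (x := ‖δ‖) (by rw [abs_of_nonneg (norm_nonneg _)]; linarith)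
      rw [abs_of_nonneg (norm_nonneg δ)] at h
      have := (abs_le.1 h).2
      linarith
    have hexpδ : ‖Complex.exp δ‖ ≤ 2 := (Complex.norm_exp_le_exp_norm δ).trans (by linarith)
    have hexpδ1 : ‖Complex.exp δ - 1‖ ≤ w / 2 := by
      refine (norm_cexp_sub_one_le δ).trans ?_
      calc 2 * ‖δ‖ * Real.exp ‖δ‖ ≤ 2 * (w / 8) * (5 / 4) := by gcongr
        _ ≤ w / 2 := by linarith
    have hmainA2 : ‖mainA‖ ≤ 2 * W' := by
      rw [hmainAeq, norm_mul, hmain_norm]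
      calc W' * ‖Complex.exp δ‖ ≤ W' * 2 := mul_le_mul_of_nonneg_left hexpδ hW'n
        _ = 2 * W' := by ring
    -- the three terms
    have T1 : ‖dobnerB t n s - mainA * g‖ ≤ w * W' + cτ * (2 * W' * (K₁ * w * Mτ + w)) := by
      refine hcore.trans (add_le_add hΔW (mul_le_mul_of_nonneg_left ?_ hcτ0.le))
      exact mul_le_mul hmainA2 (by linarith) (by positivity) (by positivity)
    have T2 : ‖mainA * (g - 1)‖ ≤ 2 * W' * w := by
      rw [norm_mul]; exact mul_le_mul hmainA2 (hg1.trans hηw) (norm_nonneg _) (by positivity)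
    have T3 : ‖mainA - main‖ ≤ W' * (w / 2) := by
      rw [hmainAeq, ← mul_sub_one, norm_mul, hmain_norm]
      exact mul_le_mul_of_nonneg_left hexpδ1 hW'n
    have e : dobnerB t n s - main = (dobnerB t n s - mainA * g) + mainA * (g - 1) + (mainA - main) := by
      ring
    rw [e, hmain_norm]
    calc ‖dobnerB t n s - mainA * g + mainA * (g - 1) + (mainA - main)‖
        ≤ ‖dobnerB t n s - mainA * g‖ + ‖mainA * (g - 1)‖ + ‖mainA - main‖ := norm_add₃_le
      _ ≤ (w * W' + cτ * (2 * W' * (K₁ * w * Mτ + w))) + 2 * W' * w + W' * (w / 2) :=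
          add_le_add (add_le_add T1 T2) T3
      _ = (7 / 2 + 2 * cτ * (K₁ * Mτ + 1)) * w * W' := by ring
      _ ≤ K * w * W' := by
          refine mul_le_mul_of_nonneg_right (mul_le_mul_of_nonneg_right ?_ hw0.le) hW'n
          rw [hKdef]
          have : 0 ≤ 2 * cτ * Sτ := by positivity
          linarith only [this]
  · -- part (ii)
    intro hreg'
    have hreg : ℓ ≤ q / τ := hreg'
    obtain ⟨hcore, hΔW⟩ := core hreg
    have T1 : ‖dobnerB t n s - mainA * g‖ ≤ W + cτ * (W * (K₁ * Mτ + Sτ)) := by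
      refine hcore.trans (add_le_add ?_ (mul_le_mul_of_nonneg_left ?_ hcτ0.le))
      · calc Δ ≤ w * W' := hΔW
          _ ≤ 1 * W := mul_le_mul hw1 hW'W hW'n zero_le_one
          _ = W := one_mul _
      · refine mul_le_mul hWle ?_ (by positivity) hWn
        have : K₁ * w * Mτ ≤ K₁ * 1 * Mτ := by gcongr
        linarith
    have T2 : ‖mainA * g‖ ≤ W * 2 := by
      rw [norm_mul]; exact mul_le_mul hWle hg2 (norm_nonneg _) hWn
    have T3 : ‖dobnerB t n s‖ ≤ ‖dobnerB t n s - mainA * g‖ + ‖mainA * g‖ := by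
      have := norm_add_le (dobnerB t n s - mainA * g) (mainA * g)
      rwa [sub_add_cancel] at this
    have hKW : (3 + cτ * (K₁ * Mτ + Sτ)) * W ≤ K * W := by
      refine mul_le_mul_of_nonneg_right ?_ hWn
      rw [hKdef]
      have : 0 ≤ cτ * (K₁ * Mτ + Sτ) := by positivity
      linarith only [this, hcτ0.le]
    have efin : K * ‖dobnerGammaT t s‖ * Real.exp (-(τ / 8) * ℓ ^ 2) * (n : ℝ) ^ (-x) = K * W := by
      rw [hWdef]; ring
    rw [efin]
    linarith

/-! ## Lemma 4 and `Λ ≥ 0` -/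

/-- **Dobner's Lemma 4 holds** (for `F = ζ`): the named fact `Literature.NumberTheory.LFunctions.dobner_lemma4` is a theorem.
[cite: Dobner2021, Lemma 4] -/
theorem dobner_lemma4_holds : dobner_lemma4 := by
  intro t ht C hC
  obtain ⟨y₁, K, hK, h12⟩ := dobner_lemma4_smallmedium ht hC
  obtain ⟨y₃, h3⟩ := dobner_lemma4_large ht C
  refine ⟨max (max y₁ y₃) 1, max K 1, lt_max_of_lt_left hK, fun s hx hy n hn ↦ ?_⟩
  have hy1 : y₁ ≤ s.im := ((le_max_left _ _).trans (le_max_left _ _)).trans hy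
  have hy3 : y₃ ≤ s.im := ((le_max_right _ _).trans (le_max_left _ _)).trans hy
  have hy0 : 0 ≤ s.im := zero_le_one.trans ((le_max_right _ _).trans hy)
  obtain ⟨hi, hii⟩ := h12 s hx hy1 n hn
  refine ⟨fun h ↦ (hi h).trans ?_, fun h ↦ (hii h).trans ?_, fun h ↦ (h3 s hx hy3 n hn h).trans ?_⟩
  · have h0 : 0 ≤ s.im ^ (-(1 / 5 : ℝ)) * ‖dobnerMainTerm t n s‖ :=
      mul_nonneg (Real.rpow_nonneg hy0 _) (norm_nonneg _)
    rw [mul_assoc, mul_assoc]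
    exact mul_le_mul_of_nonneg_right (le_max_left _ _) h0
  · have h0 : 0 ≤ ‖dobnerGammaT t s‖ * Real.exp (-(|t| / 8) * Real.log n ^ 2) * (n : ℝ) ^ (-s.re) := by
      positivity
    calc K * ‖dobnerGammaT t s‖ * Real.exp (-(|t| / 8) * Real.log n ^ 2) * (n : ℝ) ^ (-s.re)
        = K * (‖dobnerGammaT t s‖ * Real.exp (-(|t| / 8) * Real.log n ^ 2) * (n : ℝ) ^ (-s.re)) := by ring
      _ ≤ max K 1 * (‖dobnerGammaT t s‖ * Real.exp (-(|t| / 8) * Real.log n ^ 2) * (n : ℝ) ^ (-s.re)) :=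
          mul_le_mul_of_nonneg_right (le_max_left _ _) h0
      _ = _ := by ring
  · calc Real.exp (-(|t| / 10) * Real.log n ^ 2) = 1 * Real.exp (-(|t| / 10) * Real.log n ^ 2) :=
        (one_mul _).symm
      _ ≤ max K 1 * Real.exp (-(|t| / 10) * Real.log n ^ 2) :=
          mul_le_mul_of_nonneg_right (le_max_right _ _) (Real.exp_pos _).le

/-- **The de Bruijn–Newman constant is non-negative** (Rodgers–Tao 2020, Thm. 1.1; Newman's
conjecture), in the `sInf`-free form of `Literature.NumberTheory.LFunctions.rodgers_tao`: for every `t < 0` the function `H_t`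
has a non-real zero. Proved here along Dobner's route [Dobner2021] (steepest descent for the
heat-flow deformation `ξ_t`, Bohr almost periodicity of `ζ_t`, a zero of `ζ_t`, Hurwitz), all of
whose inputs are theorems of this library; the last one, Lemma 4, is `Literature.NumberTheory.LFunctions.dobner_lemma4_holds`.
[cite: RodgersTaoFMP2020, Thm. 1.1] -/
theorem rodgers_tao_holds : LFunctions.rodgers_tao :=
  LFunctions.rodgers_tao_of_dobner_lemma4 dobner_lemma4_holds

/-- **Dobner's Thm. 4, qualitative version, holds** (for `F = ζ`): the named fact
`Literature.NumberTheory.LFunctions.dobner_xiDeformed_approx` of `DobnerNewman.lean` — "if `t < 0`, `V` is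
some vertical strip, and `s = x + iy ∈ V` with `y` sufficiently large, then
`ξ_t(J_t(s)) = γ_t(s)(ζ_t(s) + o_{y→∞}(1))`, the decay of the error term being uniform in `x`"
(the display following Thm. 4 in §3 of the source) — is a theorem: Lemma 4 of the source
(`dobner_lemma4_holds`, this file; steepest descent, §4 and Lemmas 5–7) fed into the summation
argument of §4.1 (`dobner_xiDeformed_approx_of_lemma4`, `DobnerTheorem4Proofs.lean`, where the
lower bound `|γ_t(s)| ≫ e^{−K'y}` of eq. (4.9) is proved elementarily on vertical strips). Users of
`(h : dobner_xiDeformed_approx)` are fed this theorem.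
[cite: Dobner2021, Thm. 4 (qualitative version, display following it) and §4.1] -/
theorem dobner_xiDeformed_approx_holds : dobner_xiDeformed_approx :=
  dobner_xiDeformed_approx_of_lemma4 dobner_lemma4_holds


end Literature.NumberTheory.LFunctions
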